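import Literature.RepresentationTheory.ModularTensorCategories.TemperleyLieb.Recoupling

/-!
# Temperley–Lieb recoupling theory (5/6): The closed form of the `6j`-symbol: the Racah recursion, base value, the recursions `REC-P`, `REC'-P`; Identification of the recoupling coefficients with the closed form (generic `A`); Continuity in `A`, genericity off the unit circle, the root of unity `A₀ = e^{iπ/2(k+2)}`

Part of the sorry-free formalization of Kauffman–Lins' recoupling theory in the binor model
(definitions and overview: `TemperleyLieb/Defs.lean`). Theorem-only file.

## References
* L. H. Kauffman, S. Lins, *Temperley–Lieb Recoupling Theory and Invariants of 3-Manifolds* (1994). [KauffmanLins1994]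
* G. Masbaum, P. Vogel, *3-valent graphs and the Kauffman bracket*, Pacific J. Math. 164 (1994). [MasbaumVogel1994]
-/

noncomputable section

open BigOperators Finset

namespace Literature.RepresentationTheory.ModularTensorCategories

namespace TemperleyLieb

variable {K : Type*} [Field K]
variable {m n p m' n' p' m'' n'' : ℕ}

open Mor

variable {A : K}

section QZ

variable {A : K}


/-- Bookkeeping lemma `qintZ_natCast` of the binor tensor model of Temperley–Lieb recoupling theory (conventions of KL94 §8.2, §9). [folklore] -/
theorem qintZ_natCast (hA : A ≠ 0) (hq : A ^ 2 - A⁻¹ ^ 2 ≠ 0) (n : ℕ) : qintZ A (n : ℤ) = qint A n := by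
  have hq' : A ^ 2 - (A ^ 2)⁻¹ ≠ 0 := by rwa [← inv_pow]
  have h := qint_mul_eq A hA n
  simp only [inv_pow] at h
  rw [qintZ, zpow_neg, zpow_natCast, div_eq_iff hq', h, ← pow_mul]

/-- Bookkeeping lemma `qintZ_neg` of the binor tensor model of Temperley–Lieb recoupling theory (conventions of KL94 §8.2, §9). [folklore] -/
theorem qintZ_neg (n : ℤ) : qintZ A (-n) = -qintZ A n := by
  rw [qintZ, qintZ, neg_neg, ← neg_div, neg_sub]

/-- Bookkeeping lemma `qintZ_zero'` of the binor tensor model of Temperley–Lieb recoupling theory (conventions of KL94 §8.2, §9). [folklore] -/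
@[simp] theorem qintZ_zero' : qintZ A 0 = 0 := by simp [qintZ]

/-- Bookkeeping lemma `qfinv_of_neg` of the binor tensor model of Temperley–Lieb recoupling theory (conventions of KL94 §8.2, §9). [folklore] -/
theorem qfinv_of_neg {n : ℤ} (h : n < 0) : qfinv A n = 0 := by rw [qfinv, if_pos h]

/-- Bookkeeping lemma `qfinv_of_nonneg` of the binor tensor model of Temperley–Lieb recoupling theory (conventions of KL94 §8.2, §9). [folklore] -/
theorem qfinv_of_nonneg {n : ℤ} (h : 0 ≤ n) : qfinv A n = (qfact A n.toNat)⁻¹ := by rw [qfinv, if_neg (not_lt.mpr h)]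

/-- Bookkeeping lemma `qfinv_natCast` of the binor tensor model of Temperley–Lieb recoupling theory (conventions of KL94 §8.2, §9). [folklore] -/
theorem qfinv_natCast (n : ℕ) : qfinv A (n : ℤ) = (qfact A n)⁻¹ := by
  rw [qfinv_of_nonneg (Int.natCast_nonneg n), Int.toNat_natCast]

/-- The uniform shift identity `1/[n]! = [n+1] · 1/[n+1]!` for all `n ∈ ℤ` (generic `A`). [folklore] -/
theorem qfinv_eq_succ (hA : A ≠ 0) (hq : A ^ 2 - A⁻¹ ^ 2 ≠ 0) (hgen : ∀ m : ℕ, 1 ≤ m → qint A m ≠ 0) (n : ℤ) :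
    qfinv A n = qintZ A (n + 1) * qfinv A (n + 1) := by
  rcases lt_trichotomy n (-1) with h | rfl | h
  · rw [qfinv_of_neg (by omega), qfinv_of_neg (by omega), mul_zero]
  · rw [qfinv_of_neg (by omega), show (-1 : ℤ) + 1 = 0 by ring, qintZ_zero', zero_mul]
  · obtain ⟨m, rfl⟩ : ∃ m : ℕ, n = m := ⟨n.toNat, by omega⟩
    rw [qfinv_natCast, show (m : ℤ) + 1 = ((m + 1 : ℕ) : ℤ) by push_cast; rfl, qfinv_natCast, qintZ_natCast hA hq,
      qfact_succ, mul_inv, mul_comm (qfact A m)⁻¹, ← mul_assoc, mul_inv_cancel₀ (hgen (m + 1) (by omega)), one_mul]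

/-- Bookkeeping lemma `qfactZ_succ` of the binor tensor model of Temperley–Lieb recoupling theory (conventions of KL94 §8.2, §9). [folklore] -/
theorem qfactZ_succ (hA : A ≠ 0) (hq : A ^ 2 - A⁻¹ ^ 2 ≠ 0) {n : ℤ} (h : 0 ≤ n) :
    qfactZ A (n + 1) = qfactZ A n * qintZ A (n + 1) := by
  obtain ⟨m, rfl⟩ : ∃ m : ℕ, n = m := ⟨n.toNat, by omega⟩
  rw [qfactZ, qfactZ, show (m : ℤ) + 1 = ((m + 1 : ℕ) : ℤ) by push_cast; rfl, Int.toNat_natCast, Int.toNat_natCast,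
    qfact_succ, qintZ_natCast hA hq]

end QZ

/-! ### The certificate identity for the Racah-sum recursion -/

section Poly

variable {A : K}

/-- The Laurent-polynomial identity behind the three-term recursion of the alternating (Racah) sum
(balanced parameters `Σ aᵢ = Σ bⱼ`). [folklore; found by exact fitting, cf. MasbaumVogel1994 §3] [folklore] -/
theorem racah_poly (hA : A ≠ 0) (hq : A ^ 2 - A⁻¹ ^ 2 ≠ 0) (a1 a2 a3 a4 b1 b2 s : ℤ) :
    qintZ A (a1 + a2 - (a1 + a2 + a3 + a4 - b1 - b2) + 1) * qintZ A ((a1 + a2 + a3 + a4 - b1 - b2) - a3) *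
        (qintZ A (s - a1 + 1) * qintZ A (s - a2 + 1) * qintZ A (s - a4 + 1)) +
      qintZ A (a1 + 1) * qintZ A (a2 + 1) *
        (qintZ A (b1 - s) * qintZ A (b2 - s) * qintZ A ((a1 + a2 + a3 + a4 - b1 - b2) - s)) -
      qintZ A (b1 - a4 + 1) * qintZ A (b2 - a4 + 1) *
        (qintZ A (s - a1 + 1) * qintZ A (s - a2 + 1) * qintZ A ((a1 + a2 + a3 + a4 - b1 - b2) - s)) =
    -(qintZ A (s - a1 - a2) * qintZ A (s + 2) * qintZ A (b1 - s) * qintZ A (b2 - s) *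
        qintZ A ((a1 + a2 + a3 + a4 - b1 - b2) - s)) -
      qintZ A (s - a1 - a2 - 1) * qintZ A (s - a1 + 1) * qintZ A (s - a2 + 1) * qintZ A (s - a3) *
        qintZ A (s - a4 + 1) := by
  have hB0 : A ^ 2 ≠ 0 := pow_ne_zero 2 hA
  have hD : A ^ 2 - (A ^ 2)⁻¹ ≠ 0 := by rwa [← inv_pow]
  have hs := zpow_ne_zero s hB0
  have h1 := zpow_ne_zero a1 hB0
  have h2 := zpow_ne_zero a2 hB0
  have h3 := zpow_ne_zero a3 hB0
  have h4 := zpow_ne_zero a4 hB0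
  have h5 := zpow_ne_zero b1 hB0
  have h6 := zpow_ne_zero b2 hB0
  simp only [qintZ, zpow_add₀ hB0, zpow_sub₀ hB0, neg_add, neg_sub, zpow_neg, zpow_ofNat]
  field_simp
  ring

end Poly

section Racah

variable {A : K}

section
variable (hA : A ≠ 0) (hq : A ^ 2 - A⁻¹ ^ 2 ≠ 0) (hgen : ∀ m : ℕ, 1 ≤ m → qint A m ≠ 0)
include hA hq hgen

/-- The per-`s` certificate: `α t(s) + β t₋(s) - γ t₊(s) = G(s+1) - G(s)`. [folklore] -/
theorem tZ_step (a1 a2 a3 a4 b1 b2 : ℤ) (s : ℤ) (hs : 0 ≤ s) :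
    qintZ A (a1 + a2 - (a1 + a2 + a3 + a4 - b1 - b2) + 1) * qintZ A ((a1 + a2 + a3 + a4 - b1 - b2) - a3) *
        tZ A a1 a2 a3 a4 b1 b2 (a1 + a2 + a3 + a4 - b1 - b2) s +
      qintZ A (a1 + 1) * qintZ A (a2 + 1) *
        tZ A (a1 - 1) (a2 - 1) a3 (a4 - 1) (b1 - 1) (b2 - 1) (a1 + a2 + a3 + a4 - b1 - b2 - 1) s -
      qintZ A (b1 - a4 + 1) * qintZ A (b2 - a4 + 1) *
        tZ A a1 a2 a3 (a4 - 1) b1 b2 (a1 + a2 + a3 + a4 - b1 - b2 - 1) s =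
    qintZ A (s + 1 - a1 - a2 - 1) * tZ A a1 a2 (a3 + 1) a4 b1 b2 (a1 + a2 + a3 + a4 - b1 - b2) (s + 1) -
      qintZ A (s - a1 - a2 - 1) * tZ A a1 a2 (a3 + 1) a4 b1 b2 (a1 + a2 + a3 + a4 - b1 - b2) s := by
  set b3 := a1 + a2 + a3 + a4 - b1 - b2 with hb3
  set D := (-1 : K) ^ s * qfactZ A (s + 1) *
    (qfinv A (s - a1 + 1) * qfinv A (s - a2 + 1) * qfinv A (s - a3) * qfinv A (s - a4 + 1)) *
    (qfinv A (b1 - s) * qfinv A (b2 - s) * qfinv A (b3 - s)) with hD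
  have S := qfinv_eq_succ hA hq hgen
  have ht : tZ A a1 a2 a3 a4 b1 b2 b3 s = D * (qintZ A (s - a1 + 1) * qintZ A (s - a2 + 1) * qintZ A (s - a4 + 1)) := by
    rw [tZ, S (s - a1), S (s - a2), S (s - a4), hD]; ring
  have htm : tZ A (a1 - 1) (a2 - 1) a3 (a4 - 1) (b1 - 1) (b2 - 1) (b3 - 1) s =
      D * (qintZ A (b1 - s) * qintZ A (b2 - s) * qintZ A (b3 - s)) := by
    rw [tZ, show s - (a1 - 1) = s - a1 + 1 by ring, show s - (a2 - 1) = s - a2 + 1 by ring,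
      show s - (a4 - 1) = s - a4 + 1 by ring, S (b1 - 1 - s), S (b2 - 1 - s), S (b3 - 1 - s),
      show b1 - 1 - s + 1 = b1 - s by ring, show b2 - 1 - s + 1 = b2 - s by ring, show b3 - 1 - s + 1 = b3 - s by ring, hD]
    ring
  have htp : tZ A a1 a2 a3 (a4 - 1) b1 b2 (b3 - 1) s =
      D * (qintZ A (s - a1 + 1) * qintZ A (s - a2 + 1) * qintZ A (b3 - s)) := by
    rw [tZ, S (s - a1), S (s - a2), show s - (a4 - 1) = s - a4 + 1 by ring, S (b3 - 1 - s),
      show b3 - 1 - s + 1 = b3 - s by ring, hD]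
    ring
  have hG : tZ A a1 a2 (a3 + 1) a4 b1 b2 b3 s =
      D * (qintZ A (s - a1 + 1) * qintZ A (s - a2 + 1) * qintZ A (s - a3) * qintZ A (s - a4 + 1)) := by
    rw [tZ, S (s - a1), S (s - a2), S (s - a4), S (s - (a3 + 1)), show s - (a3 + 1) + 1 = s - a3 by ring, hD]
    ring
  have hG1 : tZ A a1 a2 (a3 + 1) a4 b1 b2 b3 (s + 1) =
      -(D * (qintZ A (s + 2) * qintZ A (b1 - s) * qintZ A (b2 - s) * qintZ A (b3 - s))) := by
    rw [tZ, show s + 1 - a1 = s - a1 + 1 by ring, show s + 1 - a2 = s - a2 + 1 by ring,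
      show s + 1 - (a3 + 1) = s - a3 by ring, show s + 1 - a4 = s - a4 + 1 by ring, S (b1 - (s + 1)), S (b2 - (s + 1)),
      S (b3 - (s + 1)), show b1 - (s + 1) + 1 = b1 - s by ring, show b2 - (s + 1) + 1 = b2 - s by ring,
      show b3 - (s + 1) + 1 = b3 - s by ring, show s + 1 + 1 = s + 2 by ring,
      show qfactZ A (s + 2) = qfactZ A (s + 1) * qintZ A (s + 2) by
        rw [show s + 2 = s + 1 + 1 by ring]; exact qfactZ_succ hA hq (by omega),
      zpow_add₀ (neg_ne_zero.mpr one_ne_zero), zpow_one, hD]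
    ring
  have P := racah_poly hA hq a1 a2 a3 a4 b1 b2 s
  rw [← hb3] at P
  rw [ht, htm, htp, hG, hG1, show s + 1 - a1 - a2 - 1 = s - a1 - a2 by ring]
  linear_combination D * P

/-- **The Racah-sum recursion** `[a₁+a₂-b₃+1][b₃-a₃] S(a;b) = -[a₁+1][a₂+1] S(p₋) + [b₁-a₄+1][b₂-a₄+1] S(p₊)`
(`p₋ = (a₁-1,a₂-1,a₃,a₄-1; b-1)`, `p₊ = (a₁,a₂,a₃,a₄-1; b₁,b₂,b₃-1)`, balanced parameters), by telescoping
the certificate `tZ_step`. [cite: KauffmanLins1994, §9.11; MasbaumVogel1994, §3 (method)] -/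
theorem SZ_rec (a1 a2 a3 a4 b1 b2 : ℤ) (N : ℕ) (h3 : 0 ≤ a3) (hN : b1 ≤ N) :
    qintZ A (a1 + a2 - (a1 + a2 + a3 + a4 - b1 - b2) + 1) * qintZ A ((a1 + a2 + a3 + a4 - b1 - b2) - a3) *
        SZ A a1 a2 a3 a4 b1 b2 (a1 + a2 + a3 + a4 - b1 - b2) N +
      qintZ A (a1 + 1) * qintZ A (a2 + 1) *
        SZ A (a1 - 1) (a2 - 1) a3 (a4 - 1) (b1 - 1) (b2 - 1) (a1 + a2 + a3 + a4 - b1 - b2 - 1) N -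
      qintZ A (b1 - a4 + 1) * qintZ A (b2 - a4 + 1) *
        SZ A a1 a2 a3 (a4 - 1) b1 b2 (a1 + a2 + a3 + a4 - b1 - b2 - 1) N = 0 := by
  set G : ℕ → K := fun i => qintZ A ((i : ℤ) - a1 - a2 - 1) *
    tZ A a1 a2 (a3 + 1) a4 b1 b2 (a1 + a2 + a3 + a4 - b1 - b2) (i : ℤ) with hG
  have hstep : ∀ i ∈ Finset.range (N + 1),
      qintZ A (a1 + a2 - (a1 + a2 + a3 + a4 - b1 - b2) + 1) * qintZ A ((a1 + a2 + a3 + a4 - b1 - b2) - a3) *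
          tZ A a1 a2 a3 a4 b1 b2 (a1 + a2 + a3 + a4 - b1 - b2) (i : ℤ) +
        qintZ A (a1 + 1) * qintZ A (a2 + 1) *
          tZ A (a1 - 1) (a2 - 1) a3 (a4 - 1) (b1 - 1) (b2 - 1) (a1 + a2 + a3 + a4 - b1 - b2 - 1) (i : ℤ) -
        qintZ A (b1 - a4 + 1) * qintZ A (b2 - a4 + 1) *
          tZ A a1 a2 a3 (a4 - 1) b1 b2 (a1 + a2 + a3 + a4 - b1 - b2 - 1) (i : ℤ) = G (i + 1) - G i := by
    intro i _
    rw [tZ_step hA hq hgen a1 a2 a3 a4 b1 b2 (i : ℤ) (Int.natCast_nonneg i), hG]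
    push_cast
    ring_nf
  have hG0 : G 0 = 0 := by
    rw [hG]
    simp only [tZ, Nat.cast_zero]
    rw [qfinv_of_neg (show (0 : ℤ) - (a3 + 1) < 0 by omega)]
    ring
  have hGN : G (N + 1) = 0 := by
    rw [hG]
    simp only [tZ]
    rw [qfinv_of_neg (show b1 - ((N + 1 : ℕ) : ℤ) < 0 by push_cast; omega)]
    ring
  rw [SZ, SZ, SZ, Finset.mul_sum, Finset.mul_sum, Finset.mul_sum, ← Finset.sum_add_distrib, ← Finset.sum_sub_distrib,
    Finset.sum_congr rfl hstep, Finset.sum_range_sub, hG0, hGN, sub_zero]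

end

end Racah

/-! ### Vanishing and range-independence of the Racah sum -/

section RacahAux

variable {A : K}

/-- Bookkeeping lemma `tZ_eq_zero_of_lt_a` of the binor tensor model of Temperley–Lieb recoupling theory (conventions of KL94 §8.2, §9). [folklore] -/
theorem tZ_eq_zero_of_lt_a {a1 a2 a3 a4 b1 b2 b3 s a' : ℤ} (ha : a' = a1 ∨ a' = a2 ∨ a' = a3 ∨ a' = a4) (h : s < a') :
    tZ A a1 a2 a3 a4 b1 b2 b3 s = 0 := by
  unfold tZ
  rcases ha with rfl | rfl | rfl | rfl
  · rw [qfinv_of_neg (show s - a' < 0 by omega)]; ring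
  · rw [qfinv_of_neg (show s - a' < 0 by omega)]; ring
  · rw [qfinv_of_neg (show s - a' < 0 by omega)]; ring
  · rw [qfinv_of_neg (show s - a' < 0 by omega)]; ring

/-- Bookkeeping lemma `tZ_eq_zero_of_b_lt` of the binor tensor model of Temperley–Lieb recoupling theory (conventions of KL94 §8.2, §9). [folklore] -/
theorem tZ_eq_zero_of_b_lt {a1 a2 a3 a4 b1 b2 b3 s b' : ℤ} (hb : b' = b1 ∨ b' = b2 ∨ b' = b3) (h : b' < s) :
    tZ A a1 a2 a3 a4 b1 b2 b3 s = 0 := by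
  unfold tZ
  rcases hb with rfl | rfl | rfl
  · rw [qfinv_of_neg (show b' - s < 0 by omega)]; ring
  · rw [qfinv_of_neg (show b' - s < 0 by omega)]; ring
  · rw [qfinv_of_neg (show b' - s < 0 by omega)]; ring

/-- If some `bⱼ < aᵢ` the Racah sum vanishes identically. [folklore] -/
theorem SZ_eq_zero_of_lt {a1 a2 a3 a4 b1 b2 b3 a' b' : ℤ} (ha : a' = a1 ∨ a' = a2 ∨ a' = a3 ∨ a' = a4)
    (hb : b' = b1 ∨ b' = b2 ∨ b' = b3) (h : b' < a') (N : ℕ) : SZ A a1 a2 a3 a4 b1 b2 b3 N = 0 := by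
  unfold SZ
  refine Finset.sum_eq_zero (fun s _ => ?_)
  by_cases hs : (s : ℤ) < a'
  · exact tZ_eq_zero_of_lt_a ha hs
  · exact tZ_eq_zero_of_b_lt hb (by omega)

/-- The Racah sum does not depend on the cut-off `N ≥ b₁`. [folklore] -/
theorem SZ_eq_of_le {a1 a2 a3 a4 b1 b2 b3 : ℤ} {N N' : ℕ} (hN : b1 ≤ N) (hNN' : N ≤ N') :
    SZ A a1 a2 a3 a4 b1 b2 b3 N' = SZ A a1 a2 a3 a4 b1 b2 b3 N := by
  unfold SZ
  symm
  refine Finset.sum_subset (Finset.range_mono (Nat.succ_le_succ hNN')) (fun s _ hs => ?_)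
  have h2 : N + 1 ≤ s := by simpa using hs
  exact tZ_eq_zero_of_b_lt (Or.inl rfl) (show b1 < (s : ℤ) by omega)

end RacahAux


/-! ### More on `qfactZ`, `qfinv`, `SZ` -/

section QZ2

variable {A : K}

/-- Bookkeeping lemma `qfactZ_natCast` of the binor tensor model of Temperley–Lieb recoupling theory (conventions of KL94 §8.2, §9). [folklore] -/
theorem qfactZ_natCast (n : ℕ) : qfactZ A (n : ℤ) = qfact A n := by rw [qfactZ, Int.toNat_natCast]

/-- Bookkeeping lemma `qfactZ_zero` of the binor tensor model of Temperley–Lieb recoupling theory (conventions of KL94 §8.2, §9). [folklore] -/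
@[simp] theorem qfactZ_zero : qfactZ A 0 = 1 := rfl

/-- Bookkeeping lemma `qfinv_eq_inv_qfactZ` of the binor tensor model of Temperley–Lieb recoupling theory (conventions of KL94 §8.2, §9). [folklore] -/
theorem qfinv_eq_inv_qfactZ {n : ℤ} (h : 0 ≤ n) : qfinv A n = (qfactZ A n)⁻¹ := by
  rw [qfinv_of_nonneg h, qfactZ]

/-- Bookkeeping lemma `qfactZ_ne_zero` of the binor tensor model of Temperley–Lieb recoupling theory (conventions of KL94 §8.2, §9). [folklore] -/
theorem qfactZ_ne_zero (hgen : ∀ m : ℕ, 1 ≤ m → qint A m ≠ 0) (n : ℤ) : qfactZ A n ≠ 0 := by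
  rw [qfactZ]
  generalize n.toNat = m
  induction m with
  | zero => exact one_ne_zero
  | succ m ih => rw [qfact_succ]; exact mul_ne_zero ih (hgen _ (by omega))

/-- Bookkeeping lemma `qintZ_ne_zero` of the binor tensor model of Temperley–Lieb recoupling theory (conventions of KL94 §8.2, §9). [folklore] -/
theorem qintZ_ne_zero (hA : A ≠ 0) (hq : A ^ 2 - A⁻¹ ^ 2 ≠ 0) (hgen : ∀ m : ℕ, 1 ≤ m → qint A m ≠ 0) {n : ℤ}
    (h : 1 ≤ n) : qintZ A n ≠ 0 := by
  obtain ⟨m, rfl⟩ : ∃ m : ℕ, n = m := ⟨n.toNat, by omega⟩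
  rw [qintZ_natCast hA hq]
  exact hgen m (by exact_mod_cast h)

/-- `(-1)^(n + j) = (-1)^n (-1)^j` for integer exponents. [folklore] -/
theorem negOne_zpow_add (n j : ℤ) : (-1 : K) ^ (n + j) = (-1 : K) ^ n * (-1 : K) ^ j :=
  zpow_add₀ (neg_ne_zero.mpr one_ne_zero) n j

/-- A Racah sum with `aᵢ = bⱼ` for some `i, j` has the single term `s = aᵢ`. [folklore] -/
theorem SZ_single {a1 a2 a3 a4 b1 b2 b3 a' b' : ℤ} (ha : a' = a1 ∨ a' = a2 ∨ a' = a3 ∨ a' = a4)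
    (hb : b' = b1 ∨ b' = b2 ∨ b' = b3) (hab : a' = b') {N : ℕ} (h0 : 0 ≤ a') (hN : a' ≤ N) :
    SZ A a1 a2 a3 a4 b1 b2 b3 N = tZ A a1 a2 a3 a4 b1 b2 b3 a' := by
  unfold SZ
  rw [Finset.sum_eq_single a'.toNat, Int.toNat_of_nonneg h0]
  · intro s _ hs
    have hne : (s : ℤ) ≠ a' := fun h => hs (by rw [← h, Int.toNat_natCast])
    rcases lt_or_gt_of_ne hne with h | h
    · exact tZ_eq_zero_of_lt_a ha h
    · exact tZ_eq_zero_of_b_lt hb (by rw [← hab]; exact h)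
  · intro h; exact absurd (Finset.mem_range.mpr (by omega)) h

end QZ2

section SixjP

variable {A : K}


/-- Bookkeeping lemma `sixjR_of_not` of the binor tensor model of Temperley–Lieb recoupling theory (conventions of KL94 §8.2, §9). [folklore] -/
theorem sixjR_of_not {a b l e f k : ℕ} (h : ¬(Tri a b f ∧ Tri f l e ∧ Tri b l k ∧ Tri a k e)) :
    sixjR A a b l e f k = 0 := by rw [sixjR, if_neg h]

/-- Bookkeeping lemma `sixjR_of_tri` of the binor tensor model of Temperley–Lieb recoupling theory (conventions of KL94 §8.2, §9). [folklore] -/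
theorem sixjR_of_tri {a b l e f k : ℕ} (h : Tri a b f ∧ Tri f l e ∧ Tri b l k ∧ Tri a k e) :
    sixjR A a b l e f k =
      sixjP A a b l e f k ((a + e + k) / 2 : ℕ) ((b + l + k) / 2 : ℕ) ((a + b + f) / 2 : ℕ) ((l + e + f) / 2 : ℕ) := by
  rw [sixjR, if_pos h]

section Generic

variable (hA : A ≠ 0) (hq : A ^ 2 - A⁻¹ ^ 2 ≠ 0) (hgen : ∀ m : ℕ, 1 ≤ m → qint A m ≠ 0)
include hA hq hgen

omit hA hq in
/-- **Base value** `{a b b; 0 e e} = F^{a,b,0}_{e;e,b} = 1` (strands `a = x+z, b = y+z, e = x+y`). [folklore] -/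
theorem sixjP_base (x y z : ℕ) :
    sixjP A (x + z : ℕ) (y + z : ℕ) 0 (x + y : ℕ) (x + y : ℕ) (y + z : ℕ) (x + y + z : ℕ) (y + z : ℕ) (x + y + z : ℕ)
      (x + y : ℕ) = 1 := by
  have hF := qfactZ_ne_zero (A := A) hgen
  rw [sixjP]
  push_cast
  rw [SZ_single (A := A) (a' := (x + y + z : ℤ)) (b' := (x + y + z : ℤ)) (Or.inl rfl) (Or.inr (Or.inr (by ring))) rfl
    (by positivity) (by simp only [show (x : ℤ) + y + z + (x + y + z) - (x + z) = ((x + 2 * y + z : ℕ) : ℤ) by push_cast; ring,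
      Int.toNat_natCast]; omega), tZ]
  rw [show (x : ℤ) + y + z - (x + y + z) = 0 by ring, show (x : ℤ) + y + z - (y + z) = x by ring,
    show (x : ℤ) + y + z - (x + y) = z by ring, show (x : ℤ) + y + z + (x + y + z) - (x + z) - (x + y + z) = y by ring,
    show (x : ℤ) + y + z + (x + y) - (x + y) - (x + y + z) = 0 by ring,
    show (x : ℤ) + y + z + (y + z) - (y + z) - (x + y + z) = 0 by ring,
    show (x : ℤ) + y - (x + y) = 0 by ring, show (x : ℤ) + y - 0 = x + y by ring,
    show (x : ℤ) + y + z - (x + z) = y by ring,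
    qfinv_eq_inv_qfactZ le_rfl, qfinv_eq_inv_qfactZ (by positivity), qfinv_eq_inv_qfactZ (by positivity),
    qfinv_eq_inv_qfactZ (by positivity), qfactZ_zero,
    show (y : ℤ) + z + (x + y + z) + (y + z) = (x + y + z) + 2 * (y + z) by ring, negOne_zpow_add,
    Even.neg_one_zpow (show Even (2 * ((y : ℤ) + z)) from ⟨(y : ℤ) + z, by ring⟩), mul_one]
  have hs : (-1 : K) ^ ((x : ℤ) + y + z) * (-1 : K) ^ ((x : ℤ) + y + z) = 1 := by
    rw [← negOne_zpow_add]; exact Even.neg_one_zpow ⟨_, rfl⟩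
  generalize (-1 : K) ^ ((x : ℤ) + y + z) = σ at hs ⊢
  field_simp [hF]
  linear_combination hs

omit hA hq hgen in
/-- Bookkeeping lemma `negOne_zpow_neg_three` of the binor tensor model of Temperley–Lieb recoupling theory (conventions of KL94 §8.2, §9). [folklore] -/
theorem negOne_zpow_neg_three : (-1 : K) ^ (-3 : ℤ) = -1 := by norm_num [zpow_neg]

/-- **The recursion of the closed form** (`REC-P`, case `Y₂ = a₄ - f ≥ 1`):
`F^{abl}_{e;fk} = F^{ab,l-1}_{e-1;f,k-1} + C · F^{ab,l-1}_{e-1;f,k+1}`,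
`C = -([a₁-e+1]/[k+2])([b₁-a₄+1]/[k+1])`, from the Racah recursion `SZ_rec`.
[cite: KauffmanLins1994, §9.11; MasbaumVogel1994, §3 (method)] -/
theorem sixjP_rec (a b l e f k a1 a2 a3 a4 : ℤ) (h1 : a + e + k = 2 * a1) (h2 : b + l + k = 2 * a2)
    (h3 : a + b + f = 2 * a3) (h4 : l + e + f = 2 * a4) (hk : 0 ≤ k) (ha1 : 0 ≤ a1) (ha2 : 0 ≤ a2) (ha3 : 0 ≤ a3)
    (hY2 : 1 ≤ a4 - f) (hb1 : 0 ≤ a1 + a3 - a) :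
    sixjP A a b l e f k a1 a2 a3 a4 =
      sixjP A a b (l - 1) (e - 1) f (k - 1) (a1 - 1) (a2 - 1) a3 (a4 - 1) +
        (-(qintZ A (a1 - e + 1) / qintZ A (k + 2)) * (qintZ A (a1 + a3 - a - a4 + 1) / qintZ A (k + 1))) *
          sixjP A a b (l - 1) (e - 1) f (k + 1) a1 a2 a3 (a4 - 1) := by
  have hQ : ∀ n : ℤ, 1 ≤ n → qintZ A n ≠ 0 := fun n hn => qintZ_ne_zero hA hq hgen hn
  have hq1 := hQ (k + 1) (by omega)
  have hq2 := hQ (k + 2) (by omega)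
  have hqa1 := hQ (a1 + 1) (by omega)
  have hqa2 := hQ (a2 + 1) (by omega)
  obtain ⟨N, hN⟩ : ∃ N : ℕ, N = (a1 + a3 - a).toNat := ⟨_, rfl⟩
  have hbN : a1 + a3 - a ≤ N := by rw [hN]; omega
  have hX : sixjP A a b l e f k a1 a2 a3 a4 =
      ((-1 : K) ^ (k + a1 + a2) * (qfactZ A (a3 - a) * qfactZ A (a3 - b) * qfactZ A (a3 - f)) *
        (qfactZ A (a4 - e) * qfactZ A (a4 - l) * qfactZ A (a4 - f - 1)) * qfactZ A k /
        (qfactZ A f * qfactZ A a1 * qfactZ A a2)) *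
        (qintZ A (k + 1) * qintZ A (a4 - f) / (qintZ A (a1 + 1) * qintZ A (a2 + 1))) * SZ A a1 a2 a3 a4 (a1 + a3 - a) (a1 + a4 - e) (a1 + a2 - k) N := by
    rw [sixjP, ← hN, qfactZ_succ hA hq hk, qfactZ_succ hA hq ha1, qfactZ_succ hA hq ha2,
      show a4 - f = a4 - f - 1 + 1 by ring, qfactZ_succ hA hq (by omega), show a4 - f - 1 + 1 = a4 - f by ring]
    ring
  have hX1 : sixjP A a b (l - 1) (e - 1) f (k - 1) (a1 - 1) (a2 - 1) a3 (a4 - 1) =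
      -((-1 : K) ^ (k + a1 + a2) * (qfactZ A (a3 - a) * qfactZ A (a3 - b) * qfactZ A (a3 - f)) *
        (qfactZ A (a4 - e) * qfactZ A (a4 - l) * qfactZ A (a4 - f - 1)) * qfactZ A k /
        (qfactZ A f * qfactZ A a1 * qfactZ A a2)) * SZ A (a1 - 1) (a2 - 1) a3 (a4 - 1) (a1 + a3 - a - 1) (a1 + a4 - e - 1) (a1 + a2 - k - 1) N := by
    rw [sixjP, show k - 1 + 1 = k by ring, show a4 - 1 - (e - 1) = a4 - e by ring, show a4 - 1 - (l - 1) = a4 - l by ring,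
      show a4 - 1 - f = a4 - f - 1 by ring, show a1 - 1 + a3 - a = a1 + a3 - a - 1 by ring,
      show a1 - 1 + (a4 - 1) - (e - 1) = a1 + a4 - e - 1 by ring, show a1 - 1 + (a2 - 1) - (k - 1) = a1 + a2 - k - 1 by ring,
      show a1 - 1 + 1 = a1 by ring, show a2 - 1 + 1 = a2 by ring, show k - 1 + (a1 - 1) + (a2 - 1) = (k + a1 + a2) + (-3) by ring,
      negOne_zpow_add, negOne_zpow_neg_three,
      ← SZ_eq_of_le (A := A) (N := (a1 + a3 - a - 1).toNat) (N' := N) (Int.self_le_toNat _) (by rw [hN]; omega)]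
    ring
  have hX2 : sixjP A a b (l - 1) (e - 1) f (k + 1) a1 a2 a3 (a4 - 1) =
      -((-1 : K) ^ (k + a1 + a2) * (qfactZ A (a3 - a) * qfactZ A (a3 - b) * qfactZ A (a3 - f)) *
        (qfactZ A (a4 - e) * qfactZ A (a4 - l) * qfactZ A (a4 - f - 1)) * qfactZ A k /
        (qfactZ A f * qfactZ A a1 * qfactZ A a2)) *
        (qintZ A (k + 1) * qintZ A (k + 2) / (qintZ A (a1 + 1) * qintZ A (a2 + 1))) * SZ A a1 a2 a3 (a4 - 1) (a1 + a3 - a) (a1 + a4 - e) (a1 + a2 - k - 1) N := by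
    rw [sixjP, ← hN, qfactZ_succ hA hq (show 0 ≤ k + 1 by omega), qfactZ_succ hA hq hk, show k + 1 + 1 = k + 2 by ring,
      show a4 - 1 - (e - 1) = a4 - e by ring, show a4 - 1 - (l - 1) = a4 - l by ring, show a4 - 1 - f = a4 - f - 1 by ring,
      show a1 + (a4 - 1) - (e - 1) = a1 + a4 - e by ring, show a1 + a2 - (k + 1) = a1 + a2 - k - 1 by ring,
      qfactZ_succ hA hq ha1, qfactZ_succ hA hq ha2, show k + 1 + a1 + a2 = (k + a1 + a2) + 1 by ring, negOne_zpow_add,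
      zpow_one]
    ring
  -- the Racah recursion
  have R := SZ_rec hA hq hgen a1 a2 a3 a4 (a1 + a3 - a) (a1 + a4 - e) N ha3 hbN
  rw [show a1 + a2 + a3 + a4 - (a1 + a3 - a) - (a1 + a4 - e) = a1 + a2 - k by omega] at R
  rw [show a1 + a2 - (a1 + a2 - k) + 1 = k + 1 by ring, show a1 + a2 - k - a3 = a4 - f by omega,
    show a1 + a4 - e - a4 + 1 = a1 - e + 1 by ring] at R
  rw [hX1, hX2, hX]
  generalize ((-1 : K) ^ (k + a1 + a2) * (qfactZ A (a3 - a) * qfactZ A (a3 - b) * qfactZ A (a3 - f)) *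
        (qfactZ A (a4 - e) * qfactZ A (a4 - l) * qfactZ A (a4 - f - 1)) * qfactZ A k /
        (qfactZ A f * qfactZ A a1 * qfactZ A a2)) = M
  generalize SZ A a1 a2 a3 a4 (a1 + a3 - a) (a1 + a4 - e) (a1 + a2 - k) N = S₀ at R ⊢
  generalize SZ A (a1 - 1) (a2 - 1) a3 (a4 - 1) (a1 + a3 - a - 1) (a1 + a4 - e - 1) (a1 + a2 - k - 1) N = S₁ at R ⊢
  generalize SZ A a1 a2 a3 (a4 - 1) (a1 + a3 - a) (a1 + a4 - e) (a1 + a2 - k - 1) N = S₂ at R ⊢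
  generalize qintZ A (k + 1) = Q₁ at R hq1 ⊢
  generalize qintZ A (k + 2) = Q₂ at hq2 ⊢
  generalize qintZ A (a1 + 1) = P₁ at R hqa1 ⊢
  generalize qintZ A (a2 + 1) = P₂ at R hqa2 ⊢
  generalize qintZ A (a4 - f) = Y at R ⊢
  generalize qintZ A (a1 - e + 1) = U at R ⊢
  generalize qintZ A (a1 + a3 - a - a4 + 1) = V at R ⊢
  have hC : -(U / Q₂) * (V / Q₁) * (-M * (Q₁ * Q₂ / (P₁ * P₂)) * S₂) = M * (U * V / (P₁ * P₂)) * S₂ := by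
    field_simp
  have hD : M * (Q₁ * Y / (P₁ * P₂)) * S₀ - (-M * S₁ + M * (U * V / (P₁ * P₂)) * S₂) =
      M / (P₁ * P₂) * (Q₁ * Y * S₀ + P₁ * P₂ * S₁ - V * U * S₂) := by
    field_simp
    ring
  rw [hC, ← sub_eq_zero, hD, R, mul_zero]

omit hA hq hgen in
/-- Bookkeeping lemma `negOne_zpow_neg_two` of the binor tensor model of Temperley–Lieb recoupling theory (conventions of KL94 §8.2, §9). [folklore] -/
theorem negOne_zpow_neg_two : (-1 : K) ^ (-2 : ℤ) = 1 := by norm_num [zpow_neg]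

omit hA hq hgen in
/-- Bookkeeping lemma `negOne_zpow_two` of the binor tensor model of Temperley–Lieb recoupling theory (conventions of KL94 §8.2, §9). [folklore] -/
theorem negOne_zpow_two : (-1 : K) ^ (2 : ℤ) = 1 := by norm_num

/-- **The recursion of the closed form in the stretched case** (`REC'-P`, `a₄ = f`, i.e. `f = l + e`):
`F^{abl}_{e;fk} = C₁ F^{ab,l-1}_{e+1;f,k-1} + C₂ F^{ab,l-1}_{e+1;f,k+1}` with
`C₁ = [a₃-a₂+1]/[a₄-l+1]`, `C₂ = [a₁+2][a₁-a+1][b₁-a₄+1]/([a₄-l+1][k+2][k+1])`; all three Racah sums are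
single terms and the identity reduces to `[n+r][m+r] = [n][m] + [n+m+r][r]`.
[cite: MasbaumVogel1994, Lemma 3; KauffmanLins1994, §9.11] -/
theorem sixjP_rec' (a b l e f k a1 a2 a3 a4 : ℤ) (h1 : a + e + k = 2 * a1) (h2 : b + l + k = 2 * a2)
    (h3 : a + b + f = 2 * a3) (h4 : l + e + f = 2 * a4) (hst : a4 = f) (hk : 0 ≤ k) (ha1 : 0 ≤ a1) (ha2 : 0 ≤ a2)
    (ha3 : 0 ≤ a3) (hl : 1 ≤ a4 - e) (he : 0 ≤ a4 - l) (hZ3 : 0 ≤ a3 - a1) (hY4 : 0 ≤ a1 - a)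
    (hY3 : 0 ≤ a1 + a4 - e - a3) (hX3 : 0 ≤ a1 + a3 - a - a4) :
    sixjP A a b l e f k a1 a2 a3 a4 =
      qintZ A (a3 - a2 + 1) / qintZ A (a4 - l + 1) * sixjP A a b (l - 1) (e + 1) f (k - 1) a1 (a2 - 1) a3 a4 +
        qintZ A (a1 + 2) * qintZ A (a1 - a + 1) * qintZ A (a1 + a3 - a - a4 + 1) /
            (qintZ A (a4 - l + 1) * qintZ A (k + 2) * qintZ A (k + 1)) *
          sixjP A a b (l - 1) (e + 1) f (k + 1) (a1 + 1) a2 a3 a4 := by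
  have hQ : ∀ n : ℤ, 1 ≤ n → qintZ A n ≠ 0 := fun n hn => qintZ_ne_zero hA hq hgen hn
  have hqk1 := hQ (k + 1) (by omega)
  have hqk2 := hQ (k + 2) (by omega)
  have hqel := hQ (a4 - l + 1) (by omega)
  have hqa1 := hQ (a1 + 2) (by omega)
  have hqa2 := hQ (a2 + 1) (by omega)
  have hb3 : a1 + a2 - k = a3 := by omega
  have Sh := qfinv_eq_succ hA hq hgen
  have hFf := qfactZ_ne_zero (A := A) hgen f
  have hFa1 := qfactZ_ne_zero (A := A) hgen (a1 + 1)
  have hFa2 := qfactZ_ne_zero (A := A) hgen a2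
  -- the three symbols, expanded
  have hX : sixjP A a b l e f k a1 a2 a3 a4 =
      (-1 : K) ^ (k + a1 + a2) * (qfactZ A k * qintZ A (k + 1)) * (qfactZ A (a3 - a) * qfactZ A (a3 - b) * qfactZ A (a3 - f)) *
        (qfactZ A (a4 - e - 1) * qintZ A (a4 - e) * qfactZ A (a4 - l) * 1) *
        ((-1 : K) ^ a3 * qfactZ A (a3 + 1) *
          (qfinv A (a3 - a1) * (qintZ A (a3 - a2 + 1) * qfinv A (a3 - a2 + 1)) * 1 * qfinv A (a3 - a4)) *
          (qintZ A (a1 - a + 1) * qfinv A (a1 - a + 1) * qfinv A (a1 + a4 - e - a3) * 1)) /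
        (qfactZ A f * qfactZ A (a1 + 1) * (qfactZ A a2 * qintZ A (a2 + 1))) := by
    rw [sixjP, SZ_single (A := A) (a' := a3) (b' := a1 + a2 - k) (Or.inr (Or.inr (Or.inl rfl))) (Or.inr (Or.inr rfl))
      hb3.symm ha3 (by omega), tZ, qfactZ_succ hA hq hk, qfactZ_succ hA hq ha2,
      show a4 - e = a4 - e - 1 + 1 by ring, qfactZ_succ hA hq (by omega), show a4 - e - 1 + 1 = a4 - e by ring,
      show a4 - f = 0 by omega, qfactZ_zero, show a3 - a3 = 0 by ring, show a1 + a3 - a - a3 = a1 - a by ring,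
      show a1 + a2 - k - a3 = 0 by omega, qfinv_of_nonneg le_rfl, Int.toNat_zero, qfact_zero, inv_one, Sh (a3 - a2), Sh (a1 - a),
      show a1 + a4 - e - a3 = a1 + a4 - e - a3 from rfl]
  have hX1 : sixjP A a b (l - 1) (e + 1) f (k - 1) a1 (a2 - 1) a3 a4 =
      (-1 : K) ^ (k + a1 + a2) * qfactZ A k * (qfactZ A (a3 - a) * qfactZ A (a3 - b) * qfactZ A (a3 - f)) *
        (qfactZ A (a4 - e - 1) * (qfactZ A (a4 - l) * qintZ A (a4 - l + 1)) * 1) *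
        ((-1 : K) ^ a3 * qfactZ A (a3 + 1) *
          (qfinv A (a3 - a1) * qfinv A (a3 - a2 + 1) * 1 * qfinv A (a3 - a4)) *
          (qintZ A (a1 - a + 1) * qfinv A (a1 - a + 1) * (qintZ A (a1 + a4 - e - a3) * qfinv A (a1 + a4 - e - a3)) * 1)) /
        (qfactZ A f * qfactZ A (a1 + 1) * qfactZ A a2) := by
    rw [sixjP, SZ_single (A := A) (a' := a3) (b' := a1 + (a2 - 1) - (k - 1)) (Or.inr (Or.inr (Or.inl rfl)))
      (Or.inr (Or.inr rfl)) (by omega) ha3 (by omega), tZ, show k - 1 + 1 = k by ring,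
      show k - 1 + a1 + (a2 - 1) = (k + a1 + a2) + (-2) by ring, negOne_zpow_add, negOne_zpow_neg_two, mul_one,
      show a4 - (e + 1) = a4 - e - 1 by ring, show a4 - (l - 1) = a4 - l + 1 by ring, qfactZ_succ hA hq he,
      show a4 - f = 0 by omega, qfactZ_zero, show a3 - a3 = 0 by ring, show a3 - (a2 - 1) = a3 - a2 + 1 by ring,
      show a1 + a3 - a - a3 = a1 - a by ring, show a1 + a4 - (e + 1) - a3 = (a1 + a4 - e - a3 - 1) by ring,
      show a1 + (a2 - 1) - (k - 1) - a3 = 0 by omega, qfinv_of_nonneg le_rfl, Int.toNat_zero, qfact_zero, inv_one,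
      Sh (a1 - a), Sh (a1 + a4 - e - a3 - 1), show a1 + a4 - e - a3 - 1 + 1 = a1 + a4 - e - a3 by ring,
      show a2 - 1 + 1 = a2 by ring]
  have hX2 : sixjP A a b (l - 1) (e + 1) f (k + 1) (a1 + 1) a2 a3 a4 =
      (-1 : K) ^ (k + a1 + a2) * (qfactZ A k * qintZ A (k + 1) * qintZ A (k + 2)) * (qfactZ A (a3 - a) * qfactZ A (a3 - b) * qfactZ A (a3 - f)) *
        (qfactZ A (a4 - e - 1) * (qfactZ A (a4 - l) * qintZ A (a4 - l + 1)) * 1) *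
        ((-1 : K) ^ a3 * qfactZ A (a3 + 1) *
          (qintZ A (a3 - a1) * qfinv A (a3 - a1) * (qintZ A (a3 - a2 + 1) * qfinv A (a3 - a2 + 1)) * 1 *
            qfinv A (a3 - a4)) *
          (qfinv A (a1 - a + 1) * qfinv A (a1 + a4 - e - a3) * 1)) /
        (qfactZ A f * (qfactZ A (a1 + 1) * qintZ A (a1 + 2)) * (qfactZ A a2 * qintZ A (a2 + 1))) := by
    rw [sixjP, SZ_single (A := A) (a' := a3) (b' := a1 + 1 + a2 - (k + 1)) (Or.inr (Or.inr (Or.inl rfl)))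
      (Or.inr (Or.inr rfl)) (by omega) ha3 (by omega), tZ, qfactZ_succ hA hq (show 0 ≤ k + 1 by omega),
      qfactZ_succ hA hq hk, show k + 1 + 1 = k + 2 by ring,
      show k + 1 + (a1 + 1) + a2 = (k + a1 + a2) + 2 by ring, negOne_zpow_add, negOne_zpow_two, mul_one,
      show a4 - (e + 1) = a4 - e - 1 by ring, show a4 - (l - 1) = a4 - l + 1 by ring, qfactZ_succ hA hq he,
      show a4 - f = 0 by omega, qfactZ_zero, show a3 - a3 = 0 by ring, show a3 - (a1 + 1) = a3 - a1 - 1 by ring,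
      show a1 + 1 + a3 - a - a3 = a1 - a + 1 by ring, show a1 + 1 + a4 - (e + 1) - a3 = a1 + a4 - e - a3 by ring,
      show a1 + 1 + a2 - (k + 1) - a3 = 0 by omega, qfinv_of_nonneg le_rfl, Int.toNat_zero, qfact_zero, inv_one,
      Sh (a3 - a1 - 1), show a3 - a1 - 1 + 1 = a3 - a1 by ring, Sh (a3 - a2),
      qfactZ_succ hA hq (show 0 ≤ a1 + 1 by omega), show a1 + 1 + 1 = a1 + 2 by ring, qfactZ_succ hA hq ha2]
  -- Lemma 3
  obtain ⟨X3, hX3'⟩ : ∃ n : ℕ, (n : ℤ) = a1 + a3 - a - a4 := ⟨_, Int.toNat_of_nonneg hX3⟩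
  obtain ⟨Y3, hY3'⟩ : ∃ n : ℕ, (n : ℤ) = a1 + a4 - e - a3 := ⟨_, Int.toNat_of_nonneg hY3⟩
  obtain ⟨Z3, hZ3'⟩ : ∃ n : ℕ, (n : ℤ) = a3 - a1 := ⟨_, Int.toNat_of_nonneg hZ3⟩
  have L := qint_lemma3 A hA hq (X3 + 1) Z3 Y3
  have L' : qintZ A (k + 1) * qintZ A (a4 - e) =
      qintZ A (a1 + a4 - e - a3) * qintZ A (a2 + 1) + qintZ A (a1 + a3 - a - a4 + 1) * qintZ A (a3 - a1) := by
    rw [show k + 1 = ((X3 + 1 + Y3 : ℕ) : ℤ) by push_cast; omega, show a4 - e = ((Z3 + Y3 : ℕ) : ℤ) by push_cast; omega,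
      show a2 + 1 = ((X3 + 1 + Z3 + Y3 : ℕ) : ℤ) by push_cast; omega,
      show a1 + a3 - a - a4 + 1 = ((X3 + 1 : ℕ) : ℤ) by push_cast; omega, ← hY3', ← hZ3']
    simp only [qintZ_natCast hA hq]
    linear_combination L
  rw [hX, hX1, hX2]
  generalize (-1 : K) ^ (k + a1 + a2) = σ
  generalize (-1 : K) ^ a3 = ρ
  generalize qfactZ A (a3 + 1) = T
  generalize qfinv A (a3 - a4) = I4
  generalize qfactZ A k = Fk
  generalize (qfactZ A (a3 - a) * qfactZ A (a3 - b) * qfactZ A (a3 - f)) = W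
  generalize qfactZ A (a4 - e - 1) = E1
  generalize qfactZ A (a4 - l) = Lf
  generalize qfinv A (a3 - a1) = Jz
  generalize qfinv A (a3 - a2 + 1) = Jx
  generalize qfinv A (a1 - a + 1) = Jy
  generalize qfinv A (a1 + a4 - e - a3) = J3
  generalize qfactZ A f = Ff at hFf ⊢
  generalize qfactZ A (a1 + 1) = Fa1 at hFa1 ⊢
  generalize qfactZ A a2 = Fa2 at hFa2 ⊢
  generalize qintZ A (k + 1) = qk1 at hqk1 L' ⊢
  generalize qintZ A (k + 2) = qk2 at hqk2 ⊢
  generalize qintZ A (a4 - e) = qle at L' ⊢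
  generalize qintZ A (a4 - l + 1) = qel at hqel ⊢
  generalize qintZ A (a2 + 1) = qa2 at hqa2 L' ⊢
  generalize qintZ A (a1 + 2) = qa1 at hqa1 ⊢
  generalize qintZ A (a3 - a2 + 1) = qx
  generalize qintZ A (a1 - a + 1) = qy
  generalize qintZ A (a1 + a4 - e - a3) = q3 at L' ⊢
  generalize qintZ A (a3 - a1) = qz at L' ⊢
  generalize qintZ A (a1 + a3 - a - a4 + 1) = qX3 at L' ⊢
  have hT0 : σ * (Fk * qk1) * W * (E1 * qle * Lf * 1) *
        (ρ * T * (Jz * (qx * Jx) * 1 * I4) * (qy * Jy * J3 * 1)) / (Ff * Fa1 * (Fa2 * qa2)) =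
      σ * Fk * W * E1 * Lf * ρ * T * Jz * Jx * I4 * Jy * J3 * qx * qy / (Ff * Fa1 * Fa2 * qa2) * (qk1 * qle) := by
    ring
  have hT1 : qx / qel * (σ * Fk * W * (E1 * (Lf * qel) * 1) *
        (ρ * T * (Jz * Jx * 1 * I4) * (qy * Jy * (q3 * J3) * 1)) / (Ff * Fa1 * Fa2)) =
      σ * Fk * W * E1 * Lf * ρ * T * Jz * Jx * I4 * Jy * J3 * qx * qy / (Ff * Fa1 * Fa2 * qa2) * (q3 * qa2) := by
    rw [div_mul_div_comm, div_mul_eq_mul_div,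
      div_eq_div_iff (mul_ne_zero hqel (mul_ne_zero (mul_ne_zero hFf hFa1) hFa2))
        (mul_ne_zero (mul_ne_zero (mul_ne_zero hFf hFa1) hFa2) hqa2)]
    ring
  have hT2 : qa1 * qy * qX3 / (qel * qk2 * qk1) *
        (σ * (Fk * qk1 * qk2) * W * (E1 * (Lf * qel) * 1) *
          (ρ * T * (qz * Jz * (qx * Jx) * 1 * I4) * (Jy * J3 * 1)) / (Ff * (Fa1 * qa1) * (Fa2 * qa2))) =
      σ * Fk * W * E1 * Lf * ρ * T * Jz * Jx * I4 * Jy * J3 * qx * qy / (Ff * Fa1 * Fa2 * qa2) * (qX3 * qz) := by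
    rw [div_mul_div_comm, div_mul_eq_mul_div,
      div_eq_div_iff (mul_ne_zero (mul_ne_zero (mul_ne_zero hqel hqk2) hqk1)
          (mul_ne_zero (mul_ne_zero hFf (mul_ne_zero hFa1 hqa1)) (mul_ne_zero hFa2 hqa2)))
        (mul_ne_zero (mul_ne_zero (mul_ne_zero hFf hFa1) hFa2) hqa2)]
    ring
  rw [hT0, hT1, hT2, L']
  ring

end Generic

end SixjP


/-! ## Identification of the recoupling coefficients with the closed form: structural ingredients -/

section DivShapes

/-- Division bookkeeping: `a/b · (c/d) · e / ((f/g) · h) = -(i/j)` from the cross-multiplied identity. [folklore] -/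
theorem div_shape_mm (a b c d e f g h i j : K) (hb : b ≠ 0) (hd : d ≠ 0) (hf : f ≠ 0) (hh : h ≠ 0) (hj : j ≠ 0)
    (H : a * c * e * g * j = -(i * b * d * f * h)) : a / b * (c / d) * e / (f / g * h) = -(i / j) := by
  field_simp
  linear_combination H

/-- Division bookkeeping: `(c/d) · e / ((f/g) · h) = i/j` from the cross-multiplied identity. [folklore] -/
theorem div_shape_pm (c d e f g h i j : K) (hd : d ≠ 0) (hf : f ≠ 0) (hh : h ≠ 0) (hj : j ≠ 0)
    (H : c * e * g * j = i * d * f * h) : c / d * e / (f / g * h) = i / j := by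
  field_simp
  linear_combination H

end DivShapes

namespace Mor

variable {A : K}

/-- `θ(x, z, y) ≠ 0` for generic `A`. [cite: KauffmanLins1994, §9.10] -/
theorem theta_ne_zero (hA : A ≠ 0) (hq : A ^ 2 - A⁻¹ ^ 2 ≠ 0) (x z y : ℕ) (hg : Good A (x + y + z + 1)) :
    theta A x z y ≠ 0 := by
  intro h0
  have h := theta_formula hA hq z x y hg
  rw [h0, zero_mul] at h
  refine absurd h.symm (mul_ne_zero (mul_ne_zero (mul_ne_zero (mul_ne_zero (pow_ne_zero _ (neg_ne_zero.mpr one_ne_zero))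
    (qfact_ne_zero_of_good hg le_rfl)) (qfact_ne_zero_of_good hg (by omega))) (qfact_ne_zero_of_good hg (by omega)))
    (qfact_ne_zero_of_good hg (by omega)))

/-- `θ(a, b, c) ≠ 0` for admissible triples and generic `A`. [cite: KauffmanLins1994, §9.10] -/
theorem thetaL_ne_zero_of_tri (hA : A ≠ 0) (hq : A ^ 2 - A⁻¹ ^ 2 ≠ 0) {a b c : ℕ} (h : Tri a b c)
    (hg : Good A ((a + b + c) / 2 + 1)) : thetaL A a b c ≠ 0 := by
  obtain ⟨x, z, y, rfl, rfl, rfl⟩ := h.decompose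
  rw [thetaL_eq]
  refine theta_ne_zero hA hq x z y ?_
  have : (x + z + (y + z) + (x + y)) / 2 + 1 = x + y + z + 1 := by omega
  rwa [this] at hg

/-- `θ` from its closed formula, divided form. [cite: KauffmanLins1994, §9.10] -/
theorem theta_eq_div (hA : A ≠ 0) (hq : A ^ 2 - A⁻¹ ^ 2 ≠ 0) (z x y : ℕ) (hg : Good A (x + y + z + 1)) :
    theta A x z y = (-1) ^ (x + y + z) * qfact A (x + y + z + 1) * qfact A x * qfact A y * qfact A z /
      (qfact A (x + z) * qfact A (y + z) * qfact A (x + y)) := by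
  rw [eq_div_iff (mul_ne_zero (mul_ne_zero (qfact_ne_zero_of_good hg (by omega)) (qfact_ne_zero_of_good hg (by omega)))
    (qfact_ne_zero_of_good hg (by omega)))]
  exact theta_formula hA hq z x y hg

/-- **The pentagon with `d = 1`, `c = l₀`**: only `h = k ± 1` contribute. [cite: KauffmanLins1994, §7.3 Prop. 10] -/
theorem pentagon_d1 (hA : A ≠ 0) {J : ℕ} (hgJ : Good A J) {a b l₀ e f g k : ℕ}
    (ha : a < J) (hb : b < J) (hl : l₀ + 1 < J) (h1 : 1 < J) (hf : f < J) (hg : g < J) (he : e + 1 ≤ J) (hk : k + 1 < J)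
    (hS : ∀ n : ℕ, n ≤ b + l₀ + 1 → (idm n : Mor K n n) ∈ thruSpan A J n n ⊔ Neg A n n) :
    Fco A f l₀ 1 e g (l₀ + 1) * Fco A a b (l₀ + 1) e f k =
      (if 1 ≤ k then Fco A a b l₀ g f (k - 1) * Fco A a (k - 1) 1 e g k * Fco A b l₀ 1 k (k - 1) (l₀ + 1) else 0) +
        Fco A a b l₀ g f (k + 1) * Fco A a (k + 1) 1 e g k * Fco A b l₀ 1 k (k + 1) (l₀ + 1) := by
  rw [pentagon_Fco hA hgJ ha hb (show l₀ < J by omega) h1 hf hg he hS k (l₀ + 1) (by omega) hl]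
  have hz : ∀ h : ℕ, ¬Tri h 1 k → Fco A a b l₀ g f h * Fco A a h 1 e g k * Fco A b l₀ 1 k h (l₀ + 1) = 0 := by
    intro h hT
    rw [Fco_eq_zero_of_right (a := a) (b := h) (c := 1) (e := e) (f := g) (g := k) (thetaL_of_not_tri hT),
      mul_zero, zero_mul]
  by_cases hk1 : 1 ≤ k
  · rw [if_pos hk1, Finset.sum_eq_add (k - 1) (k + 1) (by omega)]
    · rintro h - ⟨hne1, hne2⟩; exact hz h (by unfold Tri; omega)
    · intro hh; exact absurd (Finset.mem_range.mpr (by omega)) hh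
    · intro hh; exact absurd (Finset.mem_range.mpr hk) hh
  · rw [if_neg hk1, zero_add, Finset.sum_eq_single (k + 1)]
    · intro h _ hne; exact hz h (by unfold Tri; omega)
    · intro hh; exact absurd (Finset.mem_range.mpr hk) hh

/-- `V(b, 0; b) = f_b` (raw). [cite: KauffmanLins1994, §9.9] -/
theorem V_zero_val (hA : A ≠ 0) (b : ℕ) (hg : Good A b) : (V A b 0 b).val = (jw A b).val := by
  have h := congrArg Mor.val (jw_idem' hA (n := b) hg)
  rw [comp_val] at h
  rw [V_eq' b 0 0 (by omega) (by omega) (by omega), cast_val, vert_def]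
  simp only [comp_val, tens_val, stdCups_zero, idm_val, jw_zero, tensR_idR_zero, Nat.add_zero]
  rw [compR_idR (jw A b).respC]
  exact h

/-- `V^∨(b, 0; b) = f_b` (raw). [cite: KauffmanLins1994, §9.9] -/
theorem Vd_zero_val (hA : A ≠ 0) (b : ℕ) (hg : Good A b) : (Vd A b 0 b).val = (jw A b).val := by
  have h := congrArg Mor.val (jw_idem' hA (n := b) hg)
  rw [comp_val] at h
  rw [Vd_eq' b 0 0 (by omega) (by omega) (by omega), cast_val, dvert_def]
  simp only [comp_val, tens_val, stdCaps_zero, idm_val, jw_zero, tensR_idR_zero, Nat.add_zero]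
  rw [compR_idR (jw A b).respC]
  exact h

/-- `θ(b, 0, b) = Δ_b`. [cite: KauffmanLins1994, §9.10] -/
theorem thetaL_zero_mid (hA : A ≠ 0) (b : ℕ) (hg : Good A (b + 1)) : thetaL A b 0 b = Delta A b := by
  rw [thetaL_eq' b 0 0 (by omega) (by omega) (by omega)]
  simpa using theta_zero_mid hA b 0 (by simpa using hg)

/-- `Tet` with a `0` label is a `θ`: `Tnet(a, b, 0; e, e, b) = θ(a, b, e)`. [cite: KauffmanLins1994, §9.12] -/
theorem Tnet_zero_mid (hA : A ≠ 0) (a b e : ℕ) (hga : Good A a) (hgb : Good A b) (hge : Good A e) :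
    Tnet A a b 0 e e b = thetaL A a b e := by
  have h1 := congrArg Mor.val (Vd_comp_idm_tens_jw hA a b e hga hgb)
  rw [comp_val, tens_val, idm_val] at h1
  have h2 := congrArg Mor.val (V_comp_jw hA a b e hge)
  rw [comp_val] at h2
  unfold Tnet thetaL
  congr 1
  apply ext'
  simp only [treeRd, treeL, comp_val, cast_val, tens_val, idm_val, V_zero_val hA e hge, Vd_zero_val hA b hgb,
    tensR_idR_zero, Nat.add_zero]
  rw [h1, h2]

/-- **Base value**: `F^{a,b,0}_{e;e,b} = 1` for admissible `(a, b, e)` and generic `A`. [cite: KauffmanLins1994, §9.12] -/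
theorem Fco_base (hA : A ≠ 0) (hq : A ^ 2 - A⁻¹ ^ 2 ≠ 0) (a b e : ℕ) (hT : Tri a b e)
    (hg : Good A ((a + b + e) / 2 + 1)) : Fco A a b 0 e e b = 1 := by
  have hab : (a + b + e) / 2 + 1 ≥ b + 1 := by unfold Tri at hT; omega
  have hae : (a + b + e) / 2 + 1 ≥ e := by unfold Tri at hT; omega
  have haa : (a + b + e) / 2 + 1 ≥ a := by unfold Tri at hT; omega
  rw [Fco, Tnet_zero_mid hA a b e (hg.mono haa) (hg.mono (by omega)) (hg.mono hae), thetaL_zero_mid hA b (hg.mono hab)]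
  exact div_self (mul_ne_zero (thetaL_ne_zero_of_tri hA hq hT hg) (hg b (by omega)))

/-- **`E₊₊` in closed form**: `F^{x,y,1}_{z;z+1,y+1} = [x₀+1]/[x₀+y'+1]`. [cite: KauffmanLins1994, §9.12] -/
theorem Fco_pp_closed (hA : A ≠ 0) (hq : A ^ 2 - A⁻¹ ^ 2 ≠ 0) (x₀ z' y' : ℕ) (hg : Good A (x₀ + y' + z' + 3)) :
    Fco A (x₀ + 1 + z') (y' + z') 1 (x₀ + y') (x₀ + y' + 1) (y' + z' + 1) = qint A (x₀ + 1) / qint A (x₀ + y' + 1) := by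
  rw [Fco_pp hA x₀ z' y' (hg.mono (by omega)) (hg.mono (by omega)) (hg.mono (by omega)), lam_eq_qint x₀ y']
  · exact qint_ne_zero_of_good hg (by omega) (by omega)
  · rw [thetaL_eq' x₀ (z' + 1) y' (by omega) (by omega) (by omega)]
    exact theta_ne_zero hA hq x₀ (z' + 1) y' (hg.mono (by omega))

/-- **`E₋₊` in closed form** (`= 1`). [cite: KauffmanLins1994, §9.12] -/
theorem Fco_mp_closed (hA : A ≠ 0) (hq : A ^ 2 - A⁻¹ ^ 2 ≠ 0) (x' z' y' : ℕ) (hg : Good A (x' + y' + z' + 3)) :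
    Fco A (x' + z') (y' + z') 1 (x' + y' + 1) (x' + y') (y' + z' + 1) = 1 := by
  refine Fco_mp hA x' z' y' (hg.mono (by omega)) (hg.mono (by omega)) ?_
  rw [thetaL_eq' x' z' (y' + 1) (by omega) (by omega) (by omega)]
  exact theta_ne_zero hA hq x' z' (y' + 1) (hg.mono (by omega))

/-- **`E₋₋` in closed form**: `F^{x,y,1}_{z;z-1,y-1} = -[z₀+1]/[y'+z₀+2]`. [cite: KauffmanLins1994, §9.12] -/
theorem Fco_mm_closed (hA : A ≠ 0) (hq : A ^ 2 - A⁻¹ ^ 2 ≠ 0) (x' z₀ y' : ℕ) (hg : Good A (x' + y' + z₀ + 3)) :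
    Fco A (x' + z₀ + 1) (y' + z₀ + 1) 1 (x' + y' + 1) (x' + y') (y' + z₀) = -(qint A (z₀ + 1) / qint A (y' + z₀ + 2)) := by
  have hF : ∀ n, n ≤ x' + y' + z₀ + 3 → qfact A n ≠ 0 := fun n hn => qfact_ne_zero_of_good hg hn
  have hQ : ∀ n, 1 ≤ n → n ≤ x' + y' + z₀ + 3 → qint A n ≠ 0 := fun n h1 hn => qint_ne_zero_of_good hg h1 hn
  rw [Fco_mm hA x' z₀ y' (hg.mono (by omega)) (hg.mono (by omega)) (hg.mono (by omega)),
    thetaL_eq' x' (z₀ + 1) y' (by omega) (by omega) (by omega), thetaL_eq' (x' + 1) z₀ y' (by omega) (by omega) (by omega),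
    lam_eq_qint x' y' (hQ _ (by omega) (by omega)), Delta_eq_qint, Delta_eq_qint,
    theta_eq_div hA hq (z₀ + 1) x' y' (hg.mono (by omega)), theta_eq_div hA hq z₀ (x' + 1) y' (hg.mono (by omega))]
  refine div_shape_mm _ _ _ _ _ _ _ _ _ _ (hQ _ (by omega) (by omega)) ?_ ?_ ?_ (hQ _ (by omega) (by omega)) ?_
  · exact mul_ne_zero (mul_ne_zero (hF _ (by omega)) (hF _ (by omega))) (hF _ (by omega))
  · exact mul_ne_zero (mul_ne_zero (mul_ne_zero (mul_ne_zero (pow_ne_zero _ (neg_ne_zero.mpr one_ne_zero))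
      (hF _ (by omega))) (hF _ (by omega))) (hF _ (by omega))) (hF _ (by omega))
  · exact mul_ne_zero (pow_ne_zero _ (neg_ne_zero.mpr one_ne_zero)) (hQ _ (by omega) (by omega))
  · rw [show x' + y' + (z₀ + 1) + 1 = x' + y' + z₀ + 2 by omega, show x' + 1 + y' + z₀ + 1 = x' + y' + z₀ + 2 by omega,
      show x' + (z₀ + 1) = x' + z₀ + 1 by omega, show x' + 1 + z₀ = x' + z₀ + 1 by omega,
      show y' + (z₀ + 1) = y' + z₀ + 1 by omega, show x' + 1 + y' = x' + y' + 1 by omega,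
      show y' + z₀ + 1 + 1 = y' + z₀ + 2 by omega, qfact_succ A x', qfact_succ A z₀, qfact_succ A (y' + z₀),
      qfact_succ A (x' + y')]
    ring

/-- **`E₊₋` in closed form**: `F^{x,y,1}_{z;z+1,y-1} = [x₁+y₀+z₁+2][y₀+1]/([x₁+y₀+1][y₀+z₁+2])`.
[cite: KauffmanLins1994, §9.12] -/
theorem Fco_pm_closed (hA : A ≠ 0) (hq : A ^ 2 - A⁻¹ ^ 2 ≠ 0) (x₁ z₁ y₀ : ℕ) (hg : Good A (x₁ + y₀ + z₁ + 3)) :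
    Fco A (x₁ + z₁) (y₀ + z₁ + 1) 1 (x₁ + y₀) (x₁ + y₀ + 1) (y₀ + z₁) =
      qint A (x₁ + y₀ + z₁ + 2) * qint A (y₀ + 1) / (qint A (x₁ + y₀ + 1) * qint A (y₀ + z₁ + 2)) := by
  have hF : ∀ n, n ≤ x₁ + y₀ + z₁ + 3 → qfact A n ≠ 0 := fun n hn => qfact_ne_zero_of_good hg hn
  have hQ : ∀ n, 1 ≤ n → n ≤ x₁ + y₀ + z₁ + 3 → qint A n ≠ 0 := fun n h1 hn => qint_ne_zero_of_good hg h1 hn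
  rw [Fco_pm hA x₁ z₁ y₀ (hg.mono (by omega)) (hg.mono (by omega)) (hg.mono (by omega)),
    thetaL_eq' x₁ z₁ (y₀ + 1) (by omega) (by omega) (by omega), thetaL_eq' x₁ z₁ y₀ (by omega) (by omega) (by omega),
    Delta_eq_qint, Delta_eq_qint,
    theta_eq_div hA hq z₁ x₁ (y₀ + 1) (hg.mono (by omega)), theta_eq_div hA hq z₁ x₁ y₀ (hg.mono (by omega))]
  refine div_shape_pm _ _ _ _ _ _ _ _ ?_ ?_ ?_ (mul_ne_zero (hQ _ (by omega) (by omega)) (hQ _ (by omega) (by omega))) ?_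
  · exact mul_ne_zero (mul_ne_zero (hF _ (by omega)) (hF _ (by omega))) (hF _ (by omega))
  · exact mul_ne_zero (mul_ne_zero (mul_ne_zero (mul_ne_zero (pow_ne_zero _ (neg_ne_zero.mpr one_ne_zero))
      (hF _ (by omega))) (hF _ (by omega))) (hF _ (by omega))) (hF _ (by omega))
  · exact mul_ne_zero (pow_ne_zero _ (neg_ne_zero.mpr one_ne_zero)) (hQ _ (by omega) (by omega))
  · rw [show x₁ + (y₀ + 1) + z₁ + 1 = x₁ + y₀ + z₁ + 2 by omega, show x₁ + y₀ + z₁ + 1 + 1 = x₁ + y₀ + z₁ + 2 from rfl,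
      show y₀ + 1 + z₁ = y₀ + z₁ + 1 by omega, show x₁ + (y₀ + 1) = x₁ + y₀ + 1 by omega,
      show y₀ + z₁ + 1 + 1 = y₀ + z₁ + 2 from rfl,
      qfact_succ A (x₁ + y₀ + z₁ + 1), qfact_succ A y₀, qfact_succ A (y₀ + z₁), qfact_succ A (x₁ + y₀)]
    ring

end Mor


/-! ## The identification theorem `Fco = sixjR` (generic `A`) -/

section Bridge

variable {A : K}

/-- The closed form vanishes when its Racah sum does. [folklore] -/
theorem sixjP_eq_zero_of_lt {a b l e f k a1 a2 a3 a4 a' b' : ℤ} (ha : a' = a1 ∨ a' = a2 ∨ a' = a3 ∨ a' = a4)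
    (hb : b' = a1 + a3 - a ∨ b' = a1 + a4 - e ∨ b' = a1 + a2 - k) (h : b' < a') :
    sixjP A a b l e f k a1 a2 a3 a4 = 0 := by
  rw [sixjP, SZ_eq_zero_of_lt ha hb h, mul_zero, zero_div]

/-- Bridge from labels to (flexible) integer Racah parameters. [folklore] -/
theorem sixjR_eq_sixjP {a b l e f k : ℕ} (h : Tri a b f ∧ Tri f l e ∧ Tri b l k ∧ Tri a k e)
    {α β γ ε φ κ a1 a2 a3 a4 : ℤ} (hα : α = a) (hβ : β = b) (hγ : γ = l) (hε : ε = e) (hφ : φ = f) (hκ : κ = k)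
    (h1 : α + ε + κ = 2 * a1) (h2 : β + γ + κ = 2 * a2) (h3 : α + β + φ = 2 * a3) (h4 : γ + ε + φ = 2 * a4) :
    sixjR A a b l e f k = sixjP A α β γ ε φ κ a1 a2 a3 a4 := by
  subst hα hβ hγ hε hφ hκ
  have p := h.1; have p2 := h.2.1; have p3 := h.2.2.1; have p4 := h.2.2.2
  unfold Tri at p p2 p3 p4
  rw [sixjR_of_tri h, show (((a + e + k) / 2 : ℕ) : ℤ) = a1 by omega, show (((b + l + k) / 2 : ℕ) : ℤ) = a2 by omega,
    show (((a + b + f) / 2 : ℕ) : ℤ) = a3 by omega, show (((l + e + f) / 2 : ℕ) : ℤ) = a4 by omega]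

end Bridge

namespace Mor

variable {A : K}

/-- `Fco` vanishes off the admissible tetrahedra. [cite: KauffmanLins1994, §9.12] -/
theorem Fco_eq_zero_of_not_tri4 {a b c e f g : ℕ} (h : ¬(Tri a b f ∧ Tri f c e ∧ Tri b c g ∧ Tri a g e)) :
    Fco A a b c e f g = 0 := by
  by_cases h1 : Tri a b f
  · by_cases h2 : Tri f c e
    · by_cases h3 : Tri b c g
      · exact Fco_eq_zero_of_left (thetaL_of_not_tri (fun h4 => h ⟨h1, h2, h3, h4⟩))
      · exact Fco_eq_zero_of_right (thetaL_of_not_tri h3)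
    · rw [Fco, Tnet, treeL, V_of_not_tri h2, comp_zero, comp_zero, trAll_zero_mor, zero_mul, zero_div]
  · rw [Fco, Tnet, treeL, V_of_not_tri h1, zero_tens, zero_comp, comp_zero, trAll_zero_mor, zero_mul, zero_div]

/-- Bookkeeping lemma `good_of_gen` of the binor tensor model of Temperley–Lieb recoupling theory (conventions of KL94 §8.2, §9). [folklore] -/
theorem good_of_gen (hgen : ∀ m : ℕ, 1 ≤ m → qint A m ≠ 0) (N : ℕ) : Good A N := fun m _ => by
  rw [Delta_eq_qint]; exact mul_ne_zero (pow_ne_zero _ (neg_ne_zero.mpr one_ne_zero)) (hgen (m + 1) (by omega))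

/-- Relabelling of `Fco` along equal labels. [folklore] -/
theorem Fco_congr6 {a b c e f g a' b' c' e' f' g' : ℕ} (h1 : a = a') (h2 : b = b') (h3 : c = c') (h4 : e = e')
    (h5 : f = f') (h6 : g = g') : Fco A a b c e f g = Fco A a' b' c' e' f' g' := by
  subst h1 h2 h3 h4 h5 h6; rfl

/-- `x = y` and `y·u·v = C·y` give `x·u·v = C·y`. [folklore] -/
theorem mul_helper {x y u v C : K} (hxy : x = y) (h : u * v = C) : x * u * v = C * y := by
  rw [hxy, mul_assoc, h, mul_comm]

/-- **Identification of the recoupling coefficients with the closed form** (generic `A`):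
`F^{abl}_{e;fk} = Tet·Δ_k/(θθ)` computed by the trace in the binor model equals the Racah-sum closed form `sixjR`.
Induction on `l` via the label-`1` pentagon (`REC`/`REC'`) and the four elementary coefficients.
[cite: KauffmanLins1994, §9.11–§9.12 (closed formulas), §7.3 Prop. 11] -/
theorem Fco_eq_sixjR (hA : A ≠ 0) (hq : A ^ 2 - A⁻¹ ^ 2 ≠ 0) (hgen : ∀ m : ℕ, 1 ≤ m → qint A m ≠ 0) :
    ∀ (l a b e f k : ℕ), Fco A a b l e f k = sixjR A a b l e f k := by
  have hG : ∀ N, Good A N := good_of_gen hgen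
  -- the pentagon with `d = 1` is available for every size
  have P1 : ∀ {a b l₀ e f g k : ℕ}, Fco A f l₀ 1 e g (l₀ + 1) * Fco A a b (l₀ + 1) e f k =
      (if 1 ≤ k then Fco A a b l₀ g f (k - 1) * Fco A a (k - 1) 1 e g k * Fco A b l₀ 1 k (k - 1) (l₀ + 1) else 0) +
        Fco A a b l₀ g f (k + 1) * Fco A a (k + 1) 1 e g k * Fco A b l₀ 1 k (k + 1) (l₀ + 1) := by
    intro a b l₀ e f g k
    refine pentagon_d1 hA (J := a + b + l₀ + e + f + g + k + 3) (hG _) (by omega) (by omega) (by omega) (by omega)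
      (by omega) (by omega) (by omega) (by omega) (fun n hn => ?_)
    exact Submodule.mem_sup_left (thruSpan.mono (by omega) (idm_mem_thruSpan hA n (hG n)))
  intro l
  induction l with
  | zero =>
    intro a b e f k
    by_cases hT : Tri a b f ∧ Tri f 0 e ∧ Tri b 0 k ∧ Tri a k e
    · have hfe : f = e := by have := hT.2.1; unfold Tri at this; omega
      have hkb : k = b := by have := hT.2.2.1; unfold Tri at this; omega
      subst hfe hkb
      obtain ⟨x, z, y, rfl, rfl, rfl⟩ := hT.1.decompose
      rw [Fco_base hA hq _ _ _ hT.1 (hG _), sixjR_of_tri hT]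
      rw [show (x + z + (x + y) + (y + z)) / 2 = x + y + z by omega, show (y + z + 0 + (y + z)) / 2 = y + z by omega,
        show (x + z + (y + z) + (x + y)) / 2 = x + y + z by omega, show (0 + (x + y) + (x + y)) / 2 = x + y by omega,
        Nat.cast_zero]
      exact (sixjP_base hgen x y z).symm
    · rw [Fco_eq_zero_of_not_tri4 hT, sixjR_of_not hT]
  | succ l₀ IH =>
    intro a b e f k
    by_cases hT : Tri a b f ∧ Tri f (l₀ + 1) e ∧ Tri b (l₀ + 1) k ∧ Tri a k e
    swap
    · rw [Fco_eq_zero_of_not_tri4 hT, sixjR_of_not hT]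
    obtain ⟨hT1, hT2, hT3, hT4⟩ := hT
    obtain ⟨X1, Z1, Y1, ha1, hb1, hf1⟩ := hT1.decompose
    obtain ⟨X2, Z2, Y2, hf2, hl2, he2⟩ := hT2.decompose
    obtain ⟨X3, Z3, Y3, hb3, hl3, hk3⟩ := hT3.decompose
    obtain ⟨X4, Z4, Y4, ha4, hk4, he4⟩ := hT4.decompose
    -- integer Racah parameters
    have eX : sixjR A a b (l₀ + 1) e f k = sixjP A a b (l₀ + 1 : ℕ) e f k (X4 + Y4 + Z4 : ℕ) (X3 + Y3 + Z3 : ℕ)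
        (X1 + Y1 + Z1 : ℕ) (X2 + Y2 + Z2 : ℕ) :=
      sixjR_eq_sixjP ⟨hT1, hT2, hT3, hT4⟩ rfl rfl rfl rfl rfl rfl (by push_cast; omega) (by push_cast; omega)
        (by push_cast; omega) (by push_cast; omega)
    rw [eX]
    rcases Nat.eq_zero_or_pos Y2 with hY2 | hY2
    · ----------------------------------------------------------------- stretched case: REC'
      have P := @P1 a b l₀ e f (e + 1) k
      -- coefficient
      have c0 : Fco A f l₀ 1 e (e + 1) (l₀ + 1) = 1 := by
        rw [Fco_congr6 (show f = X2 + 1 + l₀ by omega) (show l₀ = 0 + l₀ by omega) rfl (show e = X2 + 0 by omega)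
          (show e + 1 = X2 + 0 + 1 by omega) (show l₀ + 1 = 0 + l₀ + 1 by omega), Fco_pp_closed hA hq X2 l₀ 0 (hG _),
          Nat.add_zero, div_self (hgen _ (by omega))]
      rw [c0, one_mul] at P
      rw [P, sixjP_rec' hA hq hgen (a := a) (b := b) (l := (l₀ + 1 : ℕ)) (e := e) (f := f) (k := k)
        (a1 := (X4 + Y4 + Z4 : ℕ)) (a2 := (X3 + Y3 + Z3 : ℕ)) (a3 := (X1 + Y1 + Z1 : ℕ)) (a4 := (X2 + Y2 + Z2 : ℕ))
        (by push_cast; omega) (by push_cast; omega) (by push_cast; omega) (by push_cast; omega) (by push_cast; omega)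
        (by positivity) (by positivity) (by positivity) (by positivity) (by push_cast; omega) (by push_cast; omega)
        (by push_cast; omega) (by push_cast; omega) (by push_cast; omega) (by push_cast; omega)]
      congr 1
      · -- first term
        by_cases hd : 1 ≤ Z4 ∧ 1 ≤ Y3
        · obtain ⟨hZ4, hY3⟩ := hd
          rw [if_pos (show 1 ≤ k by omega)]
          have c1 : Fco A a (k - 1) 1 e (e + 1) k = qint A (X4 + 1) / qint A (X4 + Y4 + 1) := by
            rw [Fco_congr6 (show a = X4 + 1 + (Z4 - 1) by omega) (show k - 1 = Y4 + (Z4 - 1) by omega) rfl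
              (show e = X4 + Y4 by omega) (show e + 1 = X4 + Y4 + 1 by omega) (show k = Y4 + (Z4 - 1) + 1 by omega)]
            exact Fco_pp_closed hA hq X4 (Z4 - 1) Y4 (hG _)
          have c2 : Fco A b l₀ 1 k (k - 1) (l₀ + 1) = 1 := by
            rw [Fco_congr6 (show b = X3 + Z3 by omega) (show l₀ = Y3 - 1 + Z3 by omega) rfl
              (show k = X3 + (Y3 - 1) + 1 by omega) (show k - 1 = X3 + (Y3 - 1) by omega) (show l₀ + 1 = Y3 - 1 + Z3 + 1 by omega)]
            exact Fco_mp_closed hA hq X3 Z3 (Y3 - 1) (hG _)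
          have hTX : Tri a b f ∧ Tri f l₀ (e + 1) ∧ Tri b l₀ (k - 1) ∧ Tri a (k - 1) (e + 1) := by
            refine ⟨hT1, ?_, ?_, ?_⟩ <;> (unfold Tri; omega)
          rw [c1, c2, mul_one, IH, mul_comm]
          rw [show ((X1 + Y1 + Z1 : ℕ) : ℤ) - (X3 + Y3 + Z3 : ℕ) + 1 = ((X4 + 1 : ℕ) : ℤ) by push_cast; omega,
            show ((X2 + Y2 + Z2 : ℕ) : ℤ) - ((l₀ + 1 : ℕ) : ℤ) + 1 = ((X4 + Y4 + 1 : ℕ) : ℤ) by push_cast; omega,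
            qintZ_natCast hA hq, qintZ_natCast hA hq]
          congr 1
          exact sixjR_eq_sixjP hTX (by omega) (by omega) (by omega) (by omega) (by omega) (by omega)
            (by push_cast; omega) (by push_cast; omega) (by push_cast; omega) (by push_cast; omega)
        · -- degenerate: both sides vanish
          have hz : (if 1 ≤ k then Fco A a b l₀ (e + 1) f (k - 1) * Fco A a (k - 1) 1 e (e + 1) k *
              Fco A b l₀ 1 k (k - 1) (l₀ + 1) else 0) = 0 := by
            split_ifs with hk
            · rcases not_and_or.mp hd with h0 | h0
              · rw [Fco_eq_zero_of_left (a := a) (g := k - 1) (e := e + 1)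
                  (thetaL_of_not_tri (by unfold Tri; omega)), zero_mul, zero_mul]
              · rw [Fco_eq_zero_of_right (b := b) (c := l₀) (g := k - 1)
                  (thetaL_of_not_tri (by unfold Tri; omega)), zero_mul, zero_mul]
            · rfl
          rw [hz]
          rcases not_and_or.mp hd with h0 | h0
          · rw [sixjP_eq_zero_of_lt (Or.inr (Or.inr (Or.inr rfl))) (Or.inr (Or.inl rfl)) ?_, mul_zero]
            push_cast; omega
          · rw [sixjP_eq_zero_of_lt (Or.inr (Or.inr (Or.inl rfl))) (Or.inr (Or.inl rfl)) ?_, mul_zero]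
            push_cast; omega
      · -- second term
        by_cases hZ3 : 1 ≤ Z3
        · have c1 : Fco A a (k + 1) 1 e (e + 1) k =
              qint A (X4 + Y4 + Z4 + 2) * qint A (Y4 + 1) / (qint A (X4 + Y4 + 1) * qint A (Y4 + Z4 + 2)) := by
            rw [Fco_congr6 (show a = X4 + Z4 by omega) (show k + 1 = Y4 + Z4 + 1 by omega) rfl (show e = X4 + Y4 by omega)
              (show e + 1 = X4 + Y4 + 1 by omega) (show k = Y4 + Z4 by omega)]
            exact Fco_pm_closed hA hq X4 Z4 Y4 (hG _)
          have c2 : Fco A b l₀ 1 k (k + 1) (l₀ + 1) = qint A (X3 + 1) / qint A (X3 + Y3 + 1) := by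
            rw [Fco_congr6 (show b = X3 + 1 + (Z3 - 1) by omega) (show l₀ = Y3 + (Z3 - 1) by omega) rfl
              (show k = X3 + Y3 by omega) (show k + 1 = X3 + Y3 + 1 by omega) (show l₀ + 1 = Y3 + (Z3 - 1) + 1 by omega)]
            exact Fco_pp_closed hA hq X3 (Z3 - 1) Y3 (hG _)
          have hTX : Tri a b f ∧ Tri f l₀ (e + 1) ∧ Tri b l₀ (k + 1) ∧ Tri a (k + 1) (e + 1) := by
            refine ⟨hT1, ?_, ?_, ?_⟩ <;> (unfold Tri; omega)
          rw [c1, c2, IH]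
          refine mul_helper (sixjR_eq_sixjP hTX (by omega) (by omega) (by omega) (by omega) (by omega) (by omega)
            (by push_cast; omega) (by push_cast; omega) (by push_cast; omega) (by push_cast; omega)) ?_
          rw [show ((X4 + Y4 + Z4 : ℕ) : ℤ) + 2 = ((X4 + Y4 + Z4 + 2 : ℕ) : ℤ) by push_cast; ring,
            show ((X4 + Y4 + Z4 : ℕ) : ℤ) - a + 1 = ((Y4 + 1 : ℕ) : ℤ) by push_cast; omega,
            show ((X4 + Y4 + Z4 : ℕ) : ℤ) + (X1 + Y1 + Z1 : ℕ) - a - (X2 + Y2 + Z2 : ℕ) + 1 = ((X3 + 1 : ℕ) : ℤ) by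
              push_cast; omega,
            show ((X2 + Y2 + Z2 : ℕ) : ℤ) - ((l₀ + 1 : ℕ) : ℤ) + 1 = ((X4 + Y4 + 1 : ℕ) : ℤ) by push_cast; omega,
            show (k : ℤ) + 2 = ((Y4 + Z4 + 2 : ℕ) : ℤ) by push_cast; omega,
            show (k : ℤ) + 1 = ((X3 + Y3 + 1 : ℕ) : ℤ) by push_cast; omega]
          simp only [qintZ_natCast hA hq]
          ring
        · have hz : Fco A a b l₀ (e + 1) f (k + 1) = 0 :=
            Fco_eq_zero_of_right (b := b) (c := l₀) (g := k + 1) (thetaL_of_not_tri (by unfold Tri; omega))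
          rw [hz, zero_mul, zero_mul, sixjP_eq_zero_of_lt (Or.inl rfl) (Or.inr (Or.inr rfl)) ?_, mul_zero]
          push_cast; omega
    · ----------------------------------------------------------------- generic case: REC
      obtain ⟨e₀, rfl⟩ : ∃ e₀, e = e₀ + 1 := ⟨e - 1, by omega⟩
      have P := @P1 a b l₀ (e₀ + 1) f e₀ k
      have c0 : Fco A f l₀ 1 (e₀ + 1) e₀ (l₀ + 1) = 1 := by
        rw [Fco_congr6 (show f = X2 + Z2 by omega) (show l₀ = Y2 - 1 + Z2 by omega) rfl
          (show e₀ + 1 = X2 + (Y2 - 1) + 1 by omega) (show e₀ = X2 + (Y2 - 1) by omega) (show l₀ + 1 = Y2 - 1 + Z2 + 1 by omega)]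
        exact Fco_mp_closed hA hq X2 Z2 (Y2 - 1) (hG _)
      rw [c0, one_mul] at P
      rw [P, sixjP_rec hA hq hgen (a := a) (b := b) (l := (l₀ + 1 : ℕ)) (e := (e₀ + 1 : ℕ)) (f := f) (k := k)
        (a1 := (X4 + Y4 + Z4 : ℕ)) (a2 := (X3 + Y3 + Z3 : ℕ)) (a3 := (X1 + Y1 + Z1 : ℕ)) (a4 := (X2 + Y2 + Z2 : ℕ))
        (by push_cast; omega) (by push_cast; omega) (by push_cast; omega) (by push_cast; omega) (by positivity)
        (by positivity) (by positivity) (by positivity) (by push_cast; omega) (by push_cast; omega)]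
      congr 1
      · -- first term
        by_cases hd : 1 ≤ Y4 ∧ 1 ≤ Y3
        · obtain ⟨hY4, hY3⟩ := hd
          rw [if_pos (show 1 ≤ k by omega)]
          have c1 : Fco A a (k - 1) 1 (e₀ + 1) e₀ k = 1 := by
            rw [Fco_congr6 (show a = X4 + Z4 by omega) (show k - 1 = Y4 - 1 + Z4 by omega) rfl
              (show e₀ + 1 = X4 + (Y4 - 1) + 1 by omega) (show e₀ = X4 + (Y4 - 1) by omega) (show k = Y4 - 1 + Z4 + 1 by omega)]
            exact Fco_mp_closed hA hq X4 Z4 (Y4 - 1) (hG _)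
          have c2 : Fco A b l₀ 1 k (k - 1) (l₀ + 1) = 1 := by
            rw [Fco_congr6 (show b = X3 + Z3 by omega) (show l₀ = Y3 - 1 + Z3 by omega) rfl
              (show k = X3 + (Y3 - 1) + 1 by omega) (show k - 1 = X3 + (Y3 - 1) by omega) (show l₀ + 1 = Y3 - 1 + Z3 + 1 by omega)]
            exact Fco_mp_closed hA hq X3 Z3 (Y3 - 1) (hG _)
          have hTX : Tri a b f ∧ Tri f l₀ e₀ ∧ Tri b l₀ (k - 1) ∧ Tri a (k - 1) e₀ := by
            refine ⟨hT1, ?_, ?_, ?_⟩ <;> (unfold Tri; omega)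
          rw [c1, c2, mul_one, mul_one, IH]
          exact sixjR_eq_sixjP hTX (by omega) (by omega) (by omega) (by omega) (by omega) (by omega)
            (by push_cast; omega) (by push_cast; omega) (by push_cast; omega) (by push_cast; omega)
        · have hz : (if 1 ≤ k then Fco A a b l₀ e₀ f (k - 1) * Fco A a (k - 1) 1 (e₀ + 1) e₀ k *
              Fco A b l₀ 1 k (k - 1) (l₀ + 1) else 0) = 0 := by
            split_ifs with hk
            · rcases not_and_or.mp hd with h0 | h0
              · rw [Fco_eq_zero_of_left (a := a) (g := k - 1) (e := e₀)
                  (thetaL_of_not_tri (by unfold Tri; omega)), zero_mul, zero_mul]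
              · rw [Fco_eq_zero_of_right (b := b) (c := l₀) (g := k - 1)
                  (thetaL_of_not_tri (by unfold Tri; omega)), zero_mul, zero_mul]
            · rfl
          rw [hz]
          rcases not_and_or.mp hd with h0 | h0
          · rw [sixjP_eq_zero_of_lt (Or.inr (Or.inr (Or.inl rfl))) (Or.inl rfl) ?_]
            push_cast; omega
          · rw [sixjP_eq_zero_of_lt (Or.inr (Or.inr (Or.inl rfl))) (Or.inr (Or.inl rfl)) ?_]
            push_cast; omega
      · -- second term
        by_cases hd : 1 ≤ X4 ∧ 1 ≤ Z3
        · obtain ⟨hX4, hZ3⟩ := hd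
          have c1 : Fco A a (k + 1) 1 (e₀ + 1) e₀ k = -(qint A (Z4 + 1) / qint A (Y4 + Z4 + 2)) := by
            rw [Fco_congr6 (show a = X4 - 1 + Z4 + 1 by omega) (show k + 1 = Y4 + Z4 + 1 by omega) rfl
              (show e₀ + 1 = X4 - 1 + Y4 + 1 by omega) (show e₀ = X4 - 1 + Y4 by omega) (show k = Y4 + Z4 by omega)]
            exact Fco_mm_closed hA hq (X4 - 1) Z4 Y4 (hG _)
          have c2 : Fco A b l₀ 1 k (k + 1) (l₀ + 1) = qint A (X3 + 1) / qint A (X3 + Y3 + 1) := by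
            rw [Fco_congr6 (show b = X3 + 1 + (Z3 - 1) by omega) (show l₀ = Y3 + (Z3 - 1) by omega) rfl
              (show k = X3 + Y3 by omega) (show k + 1 = X3 + Y3 + 1 by omega) (show l₀ + 1 = Y3 + (Z3 - 1) + 1 by omega)]
            exact Fco_pp_closed hA hq X3 (Z3 - 1) Y3 (hG _)
          have hTX : Tri a b f ∧ Tri f l₀ e₀ ∧ Tri b l₀ (k + 1) ∧ Tri a (k + 1) e₀ := by
            refine ⟨hT1, ?_, ?_, ?_⟩ <;> (unfold Tri; omega)
          rw [c1, c2, IH]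
          refine mul_helper (sixjR_eq_sixjP hTX (by omega) (by omega) (by omega) (by omega) (by omega) (by omega)
            (by push_cast; omega) (by push_cast; omega) (by push_cast; omega) (by push_cast; omega)) ?_
          rw [show ((X4 + Y4 + Z4 : ℕ) : ℤ) - ((e₀ + 1 : ℕ) : ℤ) + 1 = ((Z4 + 1 : ℕ) : ℤ) by push_cast; omega,
            show (k : ℤ) + 2 = ((Y4 + Z4 + 2 : ℕ) : ℤ) by push_cast; omega,
            show ((X4 + Y4 + Z4 : ℕ) : ℤ) + (X1 + Y1 + Z1 : ℕ) - a - (X2 + Y2 + Z2 : ℕ) + 1 = ((X3 + 1 : ℕ) : ℤ) by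
              push_cast; omega,
            show (k : ℤ) + 1 = ((X3 + Y3 + 1 : ℕ) : ℤ) by push_cast; omega]
          simp only [qintZ_natCast hA hq]
        · have hz : Fco A a b l₀ e₀ f (k + 1) = 0 := by
            rcases not_and_or.mp hd with h0 | h0
            · exact Fco_eq_zero_of_left (a := a) (g := k + 1) (e := e₀) (thetaL_of_not_tri (by unfold Tri; omega))
            · exact Fco_eq_zero_of_right (b := b) (c := l₀) (g := k + 1) (thetaL_of_not_tri (by unfold Tri; omega))
          rw [hz, zero_mul, zero_mul]
          rcases not_and_or.mp hd with h0 | h0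
          · rw [sixjP_eq_zero_of_lt (Or.inr (Or.inl rfl)) (Or.inr (Or.inr rfl)) ?_, mul_zero]
            push_cast; omega
          · rw [sixjP_eq_zero_of_lt (Or.inl rfl) (Or.inr (Or.inr rfl)) ?_, mul_zero]
            push_cast; omega

end Mor



/-! ## Continuity in the parameter `A` (over `ℂ`) -/

section Continuity

open Filter Topology Mor

variable {A₀ : ℂ}

/-- Finite sums of complex-valued functions continuous at a point of a topological space. [folklore] -/
theorem continuousAt_sum {ι α : Type*} [TopologicalSpace α] {x₀ : α} (S : Finset ι) {F : ι → α → ℂ}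
    (h : ∀ i ∈ S, ContinuousAt (F i) x₀) : ContinuousAt (fun x => ∑ i ∈ S, F i x) x₀ := by
  have := tendsto_finsetSum S h
  simpa [ContinuousAt] using this

/-- Continuity of composition, entrywise. [folklore] -/
theorem ctsv_comp {X : ℂ → Mor ℂ n p} {Y : ℂ → Mor ℂ m n} (hX : ∀ s t, ContinuousAt (fun A => (X A).val s t) A₀)
    (hY : ∀ s t, ContinuousAt (fun A => (Y A).val s t) A₀) (s t : Idx) :
    ContinuousAt (fun A => (X A ⊚ Y A).val s t) A₀ := by
  simp only [comp_val, compR]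
  exact continuousAt_sum _ (fun u _ => (hX s (pad u)).mul (hY (pad u) t))

/-- Continuity of the tensor product, entrywise. [folklore] -/
theorem ctsv_tens {X : ℂ → Mor ℂ m n} {Y : ℂ → Mor ℂ m' n'} (hX : ∀ s t, ContinuousAt (fun A => (X A).val s t) A₀)
    (hY : ∀ s t, ContinuousAt (fun A => (Y A).val s t) A₀) (s t : Idx) :
    ContinuousAt (fun A => (X A ⊗ₘ Y A).val s t) A₀ := by
  simp only [tens_val, tensR]
  exact (hX s t).mul (hY _ _)

/-- Continuity of a cast, entrywise. [folklore] -/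
theorem ctsv_cast {X : ℂ → Mor ℂ m n} (hm : m = m') (hn : n = n') (hX : ∀ s t, ContinuousAt (fun A => (X A).val s t) A₀)
    (s t : Idx) : ContinuousAt (fun A => ((X A).cast hm hn).val s t) A₀ := hX s t

/-- Continuity of a scalar multiple, entrywise. [folklore] -/
theorem ctsv_smul {c : ℂ → ℂ} {X : ℂ → Mor ℂ m n} (hc : ContinuousAt c A₀)
    (hX : ∀ s t, ContinuousAt (fun A => (X A).val s t) A₀) (s t : Idx) :
    ContinuousAt (fun A => (c A • X A).val s t) A₀ := by
  simp only [smul_val, Pi.smul_apply, smul_eq_mul]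
  exact hc.mul (hX s t)

/-- Continuity of a difference, entrywise. [folklore] -/
theorem ctsv_sub {X Y : ℂ → Mor ℂ m n} (hX : ∀ s t, ContinuousAt (fun A => (X A).val s t) A₀)
    (hY : ∀ s t, ContinuousAt (fun A => (Y A).val s t) A₀) (s t : Idx) :
    ContinuousAt (fun A => (X A - Y A).val s t) A₀ := by
  simp only [sub_val, Pi.sub_apply]
  exact (hX s t).sub (hY s t)

/-- A morphism not depending on `A` is continuous in `A`. [folklore] -/
theorem ctsv_const (X : Mor ℂ m n) (s t : Idx) : ContinuousAt (fun _ : ℂ => X.val s t) A₀ := continuousAt_const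

/-- The cup is continuous in `A ≠ 0`. [folklore] -/
theorem ctsv_cup (h0 : A₀ ≠ 0) (s t : Idx) : ContinuousAt (fun A : ℂ => (cup A : Mor ℂ 0 2).val s t) A₀ := by
  simp only [cup_val, cupR_apply]
  cases s 0 <;> cases s 1 <;> simp only [cupv_tt, cupv_tf, cupv_ft, cupv_ff]
  · exact continuousAt_const
  · exact continuousAt_inv₀ h0
  · exact continuousAt_id.neg
  · exact continuousAt_const

/-- The cap is continuous in `A ≠ 0`. [folklore] -/
theorem ctsv_cap (h0 : A₀ ≠ 0) (s t : Idx) : ContinuousAt (fun A : ℂ => (cap A : Mor ℂ 2 0).val s t) A₀ := by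
  simp only [cap_val, capR_apply]
  cases t 0 <;> cases t 1 <;> simp only [capv_tt, capv_tf, capv_ft, capv_ff]
  · exact continuousAt_const
  · exact (continuousAt_inv₀ h0).neg
  · exact continuousAt_id
  · exact continuousAt_const

/-- `d = -A² - A⁻²` is continuous in `A ≠ 0`. [folklore] -/
theorem cts_dval (h0 : A₀ ≠ 0) : ContinuousAt (fun A : ℂ => dval A) A₀ := by
  unfold dval
  exact ((continuousAt_id.pow 2).neg).sub ((continuousAt_inv₀ h0).pow 2)

/-- `Δ_n` is continuous in `A ≠ 0`. [folklore] -/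
theorem cts_Delta (h0 : A₀ ≠ 0) : ∀ n : ℕ, ContinuousAt (fun A : ℂ => Delta A n) A₀
  | 0 => by simp only [Delta_zero]; exact continuousAt_const
  | 1 => by simp only [Delta_one]; exact cts_dval h0
  | n + 2 => by
    simp only [Delta_succ_succ]
    exact ((cts_dval h0).mul (cts_Delta h0 (n + 1))).sub (cts_Delta h0 n)

/-- `[n]` is continuous in `A ≠ 0`. [folklore] -/
theorem cts_qint (h0 : A₀ ≠ 0) : ∀ n : ℕ, ContinuousAt (fun A : ℂ => qint A n) A₀
  | 0 => by simp only [qint_zero]; exact continuousAt_const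
  | 1 => by simp only [qint_one]; exact continuousAt_const
  | n + 2 => by
    simp only [qint_succ_succ]
    exact ((((continuousAt_id.pow 2)).add ((continuousAt_inv₀ h0).pow 2)).mul (cts_qint h0 (n + 1))).sub
      (cts_qint h0 n)

/-- `[n]!` is continuous in `A ≠ 0`. [folklore] -/
theorem cts_qfact (h0 : A₀ ≠ 0) : ∀ n : ℕ, ContinuousAt (fun A : ℂ => qfact A n) A₀
  | 0 => by simp only [qfact_zero]; exact continuousAt_const
  | n + 1 => by
    simp only [qfact_succ]
    exact (cts_qfact h0 n).mul (cts_qint h0 (n + 1))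

/-- The Jones–Wenzl projector is continuous in `A` at points where `Δ_0, …, Δ_{n-1} ≠ 0`. [folklore] -/
theorem ctsv_jw (h0 : A₀ ≠ 0) : ∀ n : ℕ, Good A₀ n → ∀ s t : Idx, ContinuousAt (fun A : ℂ => (jw A n).val s t) A₀
  | 0 => fun _ s t => by simp only [jw_zero]; exact continuousAt_const
  | 1 => fun _ s t => by simp only [jw_one]; exact continuousAt_const
  | n + 2 => fun hg s t => by
    have h1 := ctsv_jw h0 (n + 1) (hg.mono (by omega))
    have e : (fun A : ℂ => (jw A (n + 2)).val s t) = fun A : ℂ => ((jw A (n + 1) ⊗ₘ idm 1 :) -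
        (Delta A n / Delta A (n + 1)) • ((jw A (n + 1) ⊗ₘ idm 1 :) ⊚ (idm n ⊗ₘ U A :) ⊚ (jw A (n + 1) ⊗ₘ idm 1 :))).val s t := by
      funext A; rw [jw_succ_succ]
    rw [e]
    have hT : ∀ s t, ContinuousAt (fun A : ℂ => (jw A (n + 1) ⊗ₘ idm 1 :).val s t) A₀ :=
      ctsv_tens h1 (ctsv_const _)
    have hU : ∀ s t, ContinuousAt (fun A : ℂ => (idm n ⊗ₘ U A : Mor ℂ (n + 2) (n + 2)).val s t) A₀ := by
      intro s t
      refine ctsv_tens (ctsv_const _) (fun s t => ?_) s t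
      show ContinuousAt (fun A : ℂ => (cup A ⊚ cap A).val s t) A₀
      exact ctsv_comp (ctsv_cup h0) (ctsv_cap h0) s t
    refine ctsv_sub hT (ctsv_smul ((cts_Delta h0 n).div (cts_Delta h0 (n + 1)) (hg _ (by omega))) ?_) s t
    exact ctsv_comp (ctsv_comp hT hU) hT

/-- Positional cups are continuous in `A ≠ 0`. [folklore] -/
theorem ctsv_cupAt (h0 : A₀ ≠ 0) (n i : ℕ) (s t : Idx) : ContinuousAt (fun A : ℂ => (cupAt A n i).val s t) A₀ := by
  by_cases h : i ≤ n
  · have e : (fun A : ℂ => (cupAt A n i).val s t) =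
        fun A : ℂ => ((idm i ⊗ₘ cup A ⊗ₘ idm (n - i) :).cast (by omega) (by omega) : Mor ℂ n (n + 2)).val s t := by
      funext A; rw [cupAt, dif_pos h]
    rw [e]
    exact ctsv_cast _ _ (ctsv_tens (ctsv_tens (ctsv_const _) (ctsv_cup h0)) (ctsv_const _)) s t
  · have e : (fun A : ℂ => (cupAt A n i).val s t) = fun _ => (0 : Mor ℂ n (n + 2)).val s t := by
      funext A; rw [cupAt, dif_neg h]
    rw [e]; exact continuousAt_const

/-- Positional caps are continuous in `A ≠ 0`. [folklore] -/
theorem ctsv_capAt (h0 : A₀ ≠ 0) (n i : ℕ) (s t : Idx) : ContinuousAt (fun A : ℂ => (capAt A n i).val s t) A₀ := by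
  by_cases h : i ≤ n
  · have e : (fun A : ℂ => (capAt A n i).val s t) =
        fun A : ℂ => ((idm i ⊗ₘ cap A ⊗ₘ idm (n - i) :).cast (by omega) (by omega) : Mor ℂ (n + 2) n).val s t := by
      funext A; rw [capAt, dif_pos h]
    rw [e]
    exact ctsv_cast _ _ (ctsv_tens (ctsv_tens (ctsv_const _) (ctsv_cap h0)) (ctsv_const _)) s t
  · have e : (fun A : ℂ => (capAt A n i).val s t) = fun _ => (0 : Mor ℂ (n + 2) n).val s t := by
      funext A; rw [capAt, dif_neg h]
    rw [e]; exact continuousAt_const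

/-- The standard cups are continuous in `A ≠ 0`. [folklore] -/
theorem ctsv_stdCups (h0 : A₀ ≠ 0) (x y : ℕ) : ∀ (z : ℕ) (s t : Idx), ContinuousAt (fun A : ℂ => (stdCups A x y z).val s t) A₀
  | 0 => fun s t => by simp only [stdCups_zero]; exact continuousAt_const
  | z + 1 => fun s t => by
    simp only [stdCups_succ, cast_val, comp_val]
    exact ctsv_comp (X := fun A => cupAt A ((x + z) + (y + z)) (x + z)) (Y := fun A => stdCups A x y z)
      (ctsv_cupAt h0 _ _) (ctsv_stdCups h0 x y z) s t

/-- The standard caps are continuous in `A ≠ 0`. [folklore] -/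
theorem ctsv_stdCaps (h0 : A₀ ≠ 0) (x y : ℕ) : ∀ (z : ℕ) (s t : Idx), ContinuousAt (fun A : ℂ => (stdCaps A x y z).val s t) A₀
  | 0 => fun s t => by simp only [stdCaps_zero]; exact continuousAt_const
  | z + 1 => fun s t => by
    simp only [stdCaps_succ, cast_val, comp_val]
    exact ctsv_comp (X := fun A => stdCaps A x y z) (Y := fun A => capAt A ((x + z) + (y + z)) (x + z))
      (ctsv_stdCaps h0 x y z) (ctsv_capAt h0 _ _) s t

/-- The 3-vertex by labels is continuous in `A` (projectors of the sizes of the labels exist at `A₀`). [folklore] -/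
theorem ctsv_V (h0 : A₀ ≠ 0) (a b c : ℕ) (hga : Good A₀ a) (hgb : Good A₀ b) (hgc : Good A₀ c) (s t : Idx) :
    ContinuousAt (fun A : ℂ => (V A a b c).val s t) A₀ := by
  by_cases h : Tri a b c
  · have hx : (a + c - b) / 2 + (a + b - c) / 2 = a := by unfold Tri at h; omega
    have hy : (b + c - a) / 2 + (a + b - c) / 2 = b := by unfold Tri at h; omega
    have e : (fun A : ℂ => (V A a b c).val s t) =
        fun A : ℂ => (vert A ((a + c - b) / 2) ((a + b - c) / 2) ((b + c - a) / 2)).val s t := by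
      funext A; rw [V, dif_pos h, cast_val]
    rw [e]
    simp only [vert_def, comp_val]
    refine ctsv_comp (ctsv_comp (ctsv_tens (ctsv_jw h0 _ (by rwa [hx])) (ctsv_jw h0 _ (by rwa [hy])))
      (ctsv_stdCups h0 _ _ _)) (ctsv_jw h0 _ (by rwa [h.src])) s t
  · have e : (fun A : ℂ => (V A a b c).val s t) = fun _ => (0 : Mor ℂ c (a + b)).val s t := by
      funext A; rw [V, dif_neg h]
    rw [e]; exact continuousAt_const

/-- The dual 3-vertex by labels is continuous in `A`. [folklore] -/
theorem ctsv_Vd (h0 : A₀ ≠ 0) (a b c : ℕ) (hga : Good A₀ a) (hgb : Good A₀ b) (hgc : Good A₀ c) (s t : Idx) :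
    ContinuousAt (fun A : ℂ => (Vd A a b c).val s t) A₀ := by
  by_cases h : Tri a b c
  · have hx : (a + c - b) / 2 + (a + b - c) / 2 = a := by unfold Tri at h; omega
    have hy : (b + c - a) / 2 + (a + b - c) / 2 = b := by unfold Tri at h; omega
    have e : (fun A : ℂ => (Vd A a b c).val s t) =
        fun A : ℂ => (dvert A ((a + c - b) / 2) ((a + b - c) / 2) ((b + c - a) / 2)).val s t := by
      funext A; rw [Vd, dif_pos h, cast_val]
    rw [e]
    simp only [dvert_def, comp_val]
    refine ctsv_comp (ctsv_comp (ctsv_jw h0 _ (by rwa [h.src])) (ctsv_stdCaps h0 _ _ _))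
      (ctsv_tens (ctsv_jw h0 _ (by rwa [hx])) (ctsv_jw h0 _ (by rwa [hy]))) s t
  · have e : (fun A : ℂ => (Vd A a b c).val s t) = fun _ => (0 : Mor ℂ (a + b) c).val s t := by
      funext A; rw [Vd, dif_neg h]
    rw [e]; exact continuousAt_const

/-- The right partial trace preserves continuity in `A`. [folklore] -/
theorem ctsv_rptr (h0 : A₀ ≠ 0) {X : ℂ → Mor ℂ (m + 1) (n + 1)} (hX : ∀ s t, ContinuousAt (fun A => (X A).val s t) A₀)
    (s t : Idx) : ContinuousAt (fun A : ℂ => (rptr A (X A)).val s t) A₀ := by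
  simp only [rptr_val, compR, tensR]
  refine continuousAt_sum _ (fun u _ => (continuousAt_sum _ (fun v _ => ?_)).mul ?_)
  · exact (continuousAt_const.mul (ctsv_cap h0 (shift n s) (shift n (pad v)))).mul ((hX _ _).mul continuousAt_const)
  · exact continuousAt_const.mul (ctsv_cup h0 (shift m (pad u)) (shift m t))

/-- The full trace is continuous in `A` if the entries are. [folklore] -/
theorem cts_trAll (h0 : A₀ ≠ 0) : ∀ {n : ℕ} {X : ℂ → Mor ℂ n n},
    (∀ s t, ContinuousAt (fun A => (X A).val s t) A₀) → ContinuousAt (fun A : ℂ => trAll A (X A)) A₀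
  | 0, X, hX => by simp only [trAll_zero]; exact hX _ _
  | n + 1, X, hX => by
    simp only [trAll_succ]
    exact cts_trAll h0 (X := fun A => rptr A (X A)) (ctsv_rptr h0 hX)

/-- `θ(a, b, c)` is continuous in `A`. [folklore] -/
theorem cts_thetaL (h0 : A₀ ≠ 0) (a b c : ℕ) (hga : Good A₀ a) (hgb : Good A₀ b) (hgc : Good A₀ c) :
    ContinuousAt (fun A : ℂ => thetaL A a b c) A₀ := by
  unfold thetaL
  exact cts_trAll h0 (X := fun A => Vd A a b c ⊚ V A a b c) (ctsv_comp (ctsv_Vd h0 a b c hga hgb hgc) (ctsv_V h0 a b c hga hgb hgc))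

/-- The tetrahedral trace is continuous in `A`. [folklore] -/
theorem cts_Tnet (h0 : A₀ ≠ 0) (a b c e f g : ℕ) (hga : Good A₀ a) (hgb : Good A₀ b) (hgc : Good A₀ c) (hge : Good A₀ e)
    (hgf : Good A₀ f) (hgg : Good A₀ g) : ContinuousAt (fun A : ℂ => Tnet A a b c e f g) A₀ := by
  unfold Tnet
  refine cts_trAll h0 (X := fun A => treeRd A a b c e g ⊚ treeL A a b c e f) (ctsv_comp ?_ ?_)
  · intro s t
    simp only [treeRd, comp_val, cast_val]
    exact ctsv_comp (X := fun A => Vd A a g e) (Y := fun A => (idm a ⊗ₘ Vd A b c g : Mor ℂ (a + (b + c)) (a + g)))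
      (ctsv_Vd h0 a g e hga hgg hge) (ctsv_tens (ctsv_const _) (ctsv_Vd h0 b c g hgb hgc hgg)) s t
  · intro s t
    simp only [treeL, comp_val]
    exact ctsv_comp (X := fun A => (V A a b f ⊗ₘ idm c : Mor ℂ (f + c) (a + b + c))) (Y := fun A => V A f c e)
      (ctsv_tens (ctsv_V h0 a b f hga hgb hgf) (ctsv_const _)) (ctsv_V h0 f c e hgf hgc hge) s t

/-- **The recoupling coefficient is continuous in `A`** at points where the two `θ`-nets of its
denominator do not vanish. [folklore] -/
theorem cts_Fco (h0 : A₀ ≠ 0) (a b c e f g : ℕ) (hga : Good A₀ a) (hgb : Good A₀ b) (hgc : Good A₀ c) (hge : Good A₀ e)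
    (hgf : Good A₀ f) (hgg : Good A₀ g) (hθ : thetaL A₀ a g e * thetaL A₀ b c g ≠ 0) :
    ContinuousAt (fun A : ℂ => Fco A a b c e f g) A₀ := by
  unfold Fco
  exact ((cts_Tnet h0 a b c e f g hga hgb hgc hge hgf hgg).mul (cts_Delta h0 g)).div
    ((cts_thetaL h0 a g e hga hgg hge).mul (cts_thetaL h0 b c g hgb hgc hgg)) hθ

/-! ### Continuity of the closed form -/

/-- `[n]` (integer index) is continuous in `A` (`A ≠ 0`, `A⁴ ≠ 1`). [folklore] -/
theorem cts_qintZ (h0 : A₀ ≠ 0) (hq : A₀ ^ 2 - (A₀ ^ 2)⁻¹ ≠ 0) (n : ℤ) : ContinuousAt (fun A : ℂ => qintZ A n) A₀ := by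
  unfold qintZ
  have h2 : A₀ ^ 2 ≠ 0 := pow_ne_zero 2 h0
  refine ContinuousAt.div ?_ ?_ hq
  · exact ((continuousAt_id.pow 2).zpow₀ n (Or.inl h2)).sub ((continuousAt_id.pow 2).zpow₀ (-n) (Or.inl h2))
  · exact (continuousAt_id.pow 2).sub ((continuousAt_id.pow 2).inv₀ h2)

/-- `[n]!` (integer index) is continuous in `A ≠ 0`. [folklore] -/
theorem cts_qfactZ (h0 : A₀ ≠ 0) (n : ℤ) : ContinuousAt (fun A : ℂ => qfactZ A n) A₀ := by
  unfold qfactZ; exact cts_qfact h0 _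

/-- `1/[n]!` is continuous in `A` where `[n]! ≠ 0` (or `n < 0`). [folklore] -/
theorem cts_qfinv (h0 : A₀ ≠ 0) {n : ℤ} (h : n < 0 ∨ qfact A₀ n.toNat ≠ 0) : ContinuousAt (fun A : ℂ => qfinv A n) A₀ := by
  by_cases hn : n < 0
  · have e : (fun A : ℂ => qfinv A n) = fun _ => 0 := by funext A; rw [qfinv_of_neg hn]
    rw [e]; exact continuousAt_const
  · have e : (fun A : ℂ => qfinv A n) = fun A => (qfact A n.toNat)⁻¹ := by
      funext A; rw [qfinv_of_nonneg (not_lt.mp hn)]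
    rw [e]
    exact (cts_qfact h0 _).inv₀ (h.resolve_left hn)

/-- A term of the Racah sum is continuous in `A` if either one of its seven inverse factorials has a
negative index (the term vanishes identically) or all seven factorials are nonzero at `A₀`. [folklore] -/
theorem cts_tZ (h0 : A₀ ≠ 0) {a1 a2 a3 a4 b1 b2 b3 s : ℤ}
    (h : (s - a1 < 0 ∨ s - a2 < 0 ∨ s - a3 < 0 ∨ s - a4 < 0 ∨ b1 - s < 0 ∨ b2 - s < 0 ∨ b3 - s < 0) ∨
      (qfact A₀ (s - a1).toNat ≠ 0 ∧ qfact A₀ (s - a2).toNat ≠ 0 ∧ qfact A₀ (s - a3).toNat ≠ 0 ∧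
        qfact A₀ (s - a4).toNat ≠ 0 ∧ qfact A₀ (b1 - s).toNat ≠ 0 ∧ qfact A₀ (b2 - s).toNat ≠ 0 ∧
        qfact A₀ (b3 - s).toNat ≠ 0)) :
    ContinuousAt (fun A : ℂ => tZ A a1 a2 a3 a4 b1 b2 b3 s) A₀ := by
  rcases h with hneg | ⟨h1, h2, h3, h4, h5, h6, h7⟩
  · have e : (fun A : ℂ => tZ A a1 a2 a3 a4 b1 b2 b3 s) = fun _ => 0 := by
      funext A
      rcases hneg with h | h | h | h | h | h | h
      · exact tZ_eq_zero_of_lt_a (Or.inl rfl) (by omega)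
      · exact tZ_eq_zero_of_lt_a (Or.inr (Or.inl rfl)) (by omega)
      · exact tZ_eq_zero_of_lt_a (Or.inr (Or.inr (Or.inl rfl))) (by omega)
      · exact tZ_eq_zero_of_lt_a (Or.inr (Or.inr (Or.inr rfl))) (by omega)
      · exact tZ_eq_zero_of_b_lt (Or.inl rfl) (by omega)
      · exact tZ_eq_zero_of_b_lt (Or.inr (Or.inl rfl)) (by omega)
      · exact tZ_eq_zero_of_b_lt (Or.inr (Or.inr rfl)) (by omega)
    rw [e]; exact continuousAt_const
  · unfold tZ
    refine ((continuousAt_const.mul (cts_qfactZ h0 _)).mul ?_).mul ?_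
    · exact (((cts_qfinv h0 (Or.inr h1)).mul (cts_qfinv h0 (Or.inr h2))).mul (cts_qfinv h0 (Or.inr h3))).mul
        (cts_qfinv h0 (Or.inr h4))
    · exact ((cts_qfinv h0 (Or.inr h5)).mul (cts_qfinv h0 (Or.inr h6))).mul (cts_qfinv h0 (Or.inr h7))

end Continuity


/-! ## Off the unit circle; the limit argument; the root of unity `A₀ = e^{iπ/2r}` -/


section Generic

open Filter Topology Mor

/-- Off the unit circle no power of `A` is the corresponding power of `A⁻¹`. [folklore] -/
theorem pow_ne_inv_pow {A : ℂ} (hA : 1 < ‖A‖) {j : ℕ} (hj : 1 ≤ j) : A ^ j ≠ A⁻¹ ^ j := by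
  intro h
  have h0 : A ≠ 0 := by intro h0; rw [h0, norm_zero] at hA; exact absurd hA (by norm_num)
  have h1 : A ^ j * A ^ j = 1 := by
    rw [show A ^ j * A ^ j = A ^ j * A⁻¹ ^ j by rw [← h], ← mul_pow, mul_inv_cancel₀ h0, one_pow]
  have h2 : ‖A‖ ^ (j + j) = 1 := by rw [pow_add, ← norm_pow, ← norm_mul, h1, norm_one]
  have h3 : 1 < ‖A‖ ^ (j + j) := one_lt_pow₀ hA (by omega)
  rw [h2] at h3
  exact lt_irrefl _ h3

/-- Off the unit circle `A² ≠ A⁻²`. [folklore] -/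
theorem hq_of_one_lt_norm {A : ℂ} (hA : 1 < ‖A‖) : A ^ 2 - A⁻¹ ^ 2 ≠ 0 :=
  sub_ne_zero.mpr (pow_ne_inv_pow hA (by norm_num))

/-- Off the unit circle every quantum integer `[m]`, `m ≥ 1`, is nonzero. [folklore] -/
theorem qint_ne_zero_of_one_lt_norm {A : ℂ} (hA : 1 < ‖A‖) (m : ℕ) (hm : 1 ≤ m) : qint A m ≠ 0 := by
  intro h
  have h0 : A ≠ 0 := by intro h0; rw [h0, norm_zero] at hA; exact absurd hA (by norm_num)
  have key := qint_mul_eq A h0 m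
  rw [h, zero_mul] at key
  exact pow_ne_inv_pow hA (show 1 ≤ 2 * m by omega) (by linear_combination -key)

/-- **Limit transfer**: a function continuous at a point of the unit circle and vanishing off the unit
circle (outside) vanishes at that point. [folklore] -/
theorem eq_zero_of_generic {g : ℂ → ℂ} {A₀ : ℂ} (hA₀ : ‖A₀‖ = 1) (hg : ContinuousAt g A₀)
    (h : ∀ A : ℂ, 1 < ‖A‖ → g A = 0) : g A₀ = 0 := by
  set u : ℕ → ℂ := fun n => A₀ * ((1 + 1 / ((n : ℝ) + 1) : ℝ) : ℂ) with hu
  have hu1 : ∀ n, 1 < ‖u n‖ := by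
    intro n
    have hpos : (0 : ℝ) < 1 / ((n : ℝ) + 1) := by positivity
    rw [hu]
    simp only [norm_mul, hA₀, one_mul, Complex.norm_real, Real.norm_eq_abs]
    rw [abs_of_pos (by positivity)]
    linarith
  have hlim : Tendsto u atTop (𝓝 A₀) := by
    have h1 : Tendsto (fun n : ℕ => (1 + 1 / ((n : ℝ) + 1) : ℝ)) atTop (𝓝 (1 + 0)) :=
      tendsto_const_nhds.add tendsto_one_div_add_atTop_nhds_zero_nat
    have h2 : Tendsto (fun n : ℕ => ((1 + 1 / ((n : ℝ) + 1) : ℝ) : ℂ)) atTop (𝓝 (((1 + 0 : ℝ)) : ℂ)) :=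
      (Complex.continuous_ofReal.tendsto _).comp h1
    have h3 := (tendsto_const_nhds (x := A₀)).mul h2
    simpa [hu] using h3
  have hgu : Tendsto (g ∘ u) atTop (𝓝 (g A₀)) := hg.tendsto.comp hlim
  have hz : g ∘ u = fun _ => 0 := funext fun n => h _ (hu1 n)
  rw [hz] at hgu
  exact (tendsto_nhds_unique tendsto_const_nhds hgu).symm

/-- **The θ-net formula on the unit circle** (labels whose projectors exist at `A₀`), by continuity from the
generic formula. [cite: KauffmanLins1994, §9.10; MasbaumVogel1994, Thm 1] -/
theorem theta_formula_lim {A₀ : ℂ} (hA₀ : ‖A₀‖ = 1) (z x y : ℕ) (hgx : Good A₀ (x + z)) (hgy : Good A₀ (y + z))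
    (hgxy : Good A₀ (x + y)) :
    theta A₀ x z y * (qfact A₀ (x + z) * qfact A₀ (y + z) * qfact A₀ (x + y)) =
      (-1) ^ (x + y + z) * qfact A₀ (x + y + z + 1) * qfact A₀ x * qfact A₀ y * qfact A₀ z := by
  have h0 : A₀ ≠ 0 := by intro h; rw [h, norm_zero] at hA₀; exact zero_ne_one hA₀
  have key := eq_zero_of_generic (g := fun A => theta A x z y * (qfact A (x + z) * qfact A (y + z) * qfact A (x + y)) -
      (-1) ^ (x + y + z) * qfact A (x + y + z + 1) * qfact A x * qfact A y * qfact A z) hA₀ ?_ ?_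
  · exact sub_eq_zero.mp key
  · refine ContinuousAt.sub (ContinuousAt.mul ?_ (((cts_qfact h0 _).mul (cts_qfact h0 _)).mul (cts_qfact h0 _))) ?_
    · have e : (fun A : ℂ => theta A x z y) = fun A => thetaL A (x + z) (y + z) (x + y) := by
        funext A; rw [thetaL_eq]
      rw [e]; exact cts_thetaL h0 _ _ _ hgx hgy hgxy
    · exact (((continuousAt_const.mul (cts_qfact h0 _)).mul (cts_qfact h0 _)).mul (cts_qfact h0 _)).mul (cts_qfact h0 _)
  · intro A hA
    have hA0 : A ≠ 0 := by intro h; rw [h, norm_zero] at hA; exact absurd hA (by norm_num)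
    exact sub_eq_zero.mpr (theta_formula hA0 (hq_of_one_lt_norm hA) z x y
      (good_of_gen (qint_ne_zero_of_one_lt_norm hA) _))

end Generic

section RootOfUnity

open Complex Mor

/-- `A₀ = e^{iθ}`, `θ = π/(2(k+2))`. [cite: KauffmanLins1994, §9.4] -/
theorem klA_eq (k : ℕ) : klA k = Complex.exp (((Real.pi / (2 * ((k : ℝ) + 2)) : ℝ) : ℂ) * I) := by
  unfold klA; congr 1; push_cast; ring

/-- `A₀ ≠ 0`. [folklore] -/
theorem klA_ne_zero (k : ℕ) : klA k ≠ 0 := by rw [klA_eq]; exact Complex.exp_ne_zero _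

/-- `|A₀| = 1`. [folklore] -/
theorem norm_klA (k : ℕ) : ‖klA k‖ = 1 := by rw [klA_eq]; exact Complex.norm_exp_ofReal_mul_I _

/-- `e^{ix} - e^{-ix} = 2 i sin x`. [folklore] -/
theorem exp_mul_I_sub_exp_neg (x : ℝ) :
    Complex.exp ((x : ℂ) * I) - Complex.exp (-((x : ℂ) * I)) = 2 * (Real.sin x : ℂ) * I := by
  rw [show -((x : ℂ) * I) = ((-x : ℝ) : ℂ) * I by push_cast; ring, Complex.exp_mul_I, Complex.exp_mul_I,
    ← Complex.ofReal_sin, ← Complex.ofReal_cos, ← Complex.ofReal_sin, ← Complex.ofReal_cos, Real.sin_neg, Real.cos_neg]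
  push_cast
  ring

/-- Even powers of `A₀` are points of the unit circle: `A₀^{2n} = e^{i n π/(k+2)}`. [folklore] -/
theorem klA_pow_two_mul (k n : ℕ) : klA k ^ (2 * n) = Complex.exp ((((n : ℝ) * Real.pi / ((k : ℝ) + 2) : ℝ) : ℂ) * I) := by
  rw [klA_eq, ← Complex.exp_nat_mul]
  congr 1
  have hk : ((k : ℂ) + 2) ≠ 0 := by exact_mod_cast (show (k + 2 : ℕ) ≠ 0 by omega)
  push_cast
  field_simp

/-- `0 < sin(nπ/(k+2))` for `1 ≤ n ≤ k + 1`. [folklore] -/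
theorem sin_klA_pos (k n : ℕ) (h1 : 1 ≤ n) (h2 : n ≤ k + 1) : 0 < Real.sin ((n : ℝ) * Real.pi / ((k : ℝ) + 2)) := by
  have hk : (0 : ℝ) < k + 2 := by positivity
  apply Real.sin_pos_of_pos_of_lt_pi
  · have : (0 : ℝ) < n := by exact_mod_cast h1
    positivity
  · rw [div_lt_iff₀ hk]
    have : (n : ℝ) ≤ k + 1 := by exact_mod_cast h2
    nlinarith [Real.pi_pos]

/-- **The quantum integers at `A₀`**: `[n] = sin(nπ/(k+2))/sin(π/(k+2))`. [cite: KauffmanLins1994, §9.4] -/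
theorem qint_klA (k n : ℕ) :
    qint (klA k) n = ((Real.sin ((n : ℝ) * Real.pi / ((k : ℝ) + 2)) / Real.sin (Real.pi / ((k : ℝ) + 2)) : ℝ) : ℂ) := by
  have h0 := klA_ne_zero k
  have hs1 : Real.sin (Real.pi / ((k : ℝ) + 2)) ≠ 0 := by
    have := sin_klA_pos k 1 le_rfl (by omega)
    rw [Nat.cast_one, one_mul] at this
    exact this.ne'
  have key := qint_mul_eq (klA k) h0 n
  have p2 := klA_pow_two_mul k 1
  rw [Nat.cast_one, one_mul, mul_one] at p2
  rw [inv_pow, inv_pow, klA_pow_two_mul, p2, ← Complex.exp_neg, ← Complex.exp_neg, exp_mul_I_sub_exp_neg,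
    exp_mul_I_sub_exp_neg] at key
  have hne : (2 * (Real.sin (Real.pi / ((k : ℝ) + 2)) : ℂ) * I) ≠ 0 := by
    refine mul_ne_zero (mul_ne_zero two_ne_zero ?_) Complex.I_ne_zero
    exact_mod_cast hs1
  rw [← mul_div_cancel_right₀ (qint (klA k) n) hne, key]
  push_cast
  field_simp

/-- `A₀² - A₀⁻² ≠ 0`. [folklore] -/
theorem hq_klA (k : ℕ) : klA k ^ 2 - (klA k)⁻¹ ^ 2 ≠ 0 := by
  have hs1 : Real.sin (Real.pi / ((k : ℝ) + 2)) ≠ 0 := by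
    have := sin_klA_pos k 1 le_rfl (by omega)
    rw [Nat.cast_one, one_mul] at this
    exact this.ne'
  have p2 := klA_pow_two_mul k 1
  rw [Nat.cast_one, one_mul, mul_one] at p2
  rw [inv_pow, p2, ← Complex.exp_neg, exp_mul_I_sub_exp_neg]
  refine mul_ne_zero (mul_ne_zero two_ne_zero ?_) Complex.I_ne_zero
  exact_mod_cast hs1

/-- `A₀² - (A₀²)⁻¹ ≠ 0` (the same, reshaped). [folklore] -/
theorem hq_klA' (k : ℕ) : klA k ^ 2 - (klA k ^ 2)⁻¹ ≠ 0 := by rw [← inv_pow]; exact hq_klA k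

/-- `[n] ≠ 0` at `A₀` for `1 ≤ n ≤ k + 1`. [cite: KauffmanLins1994, §9.4, Lemma 7.4] -/
theorem qint_klA_ne_zero (k : ℕ) {n : ℕ} (h1 : 1 ≤ n) (h2 : n ≤ k + 1) : qint (klA k) n ≠ 0 := by
  rw [qint_klA]
  have hs := sin_klA_pos k n h1 h2
  have hs1 : 0 < Real.sin (Real.pi / ((k : ℝ) + 2)) := by
    have := sin_klA_pos k 1 le_rfl (by omega); rwa [Nat.cast_one, one_mul] at this
  exact_mod_cast (div_pos hs hs1).ne'

/-- `[k+2] = 0` at `A₀` (`q = A₀²` is a primitive `2(k+2)`-th root of unity). [cite: KauffmanLins1994, §9.4] -/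
theorem qint_klA_r (k : ℕ) : qint (klA k) (k + 2) = 0 := by
  rw [qint_klA]
  have : ((k + 2 : ℕ) : ℝ) * Real.pi / ((k : ℝ) + 2) = Real.pi := by push_cast; field_simp
  rw [this, Real.sin_pi, zero_div]
  simp

/-- `[n]! ≠ 0` at `A₀` for `n ≤ k + 1`. [folklore] -/
theorem qfact_klA_ne_zero (k : ℕ) : ∀ {n : ℕ}, n ≤ k + 1 → qfact (klA k) n ≠ 0
  | 0, _ => one_ne_zero
  | n + 1, h => by
    rw [qfact_succ]; exact mul_ne_zero (qfact_klA_ne_zero k (by omega)) (qint_klA_ne_zero k (by omega) h)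

/-- `[n]! = 0` at `A₀` for `n ≥ k + 2`. [folklore] -/
theorem qfact_klA_eq_zero (k : ℕ) : ∀ {n : ℕ}, k + 2 ≤ n → qfact (klA k) n = 0
  | 0, h => absurd h (by omega)
  | n + 1, h => by
    rcases Nat.eq_or_lt_of_le h with h' | h'
    · rw [qfact_succ, ← h', qint_klA_r, mul_zero]
    · rw [qfact_succ, qfact_klA_eq_zero k (by omega), zero_mul]

/-- `Δ_0, …, Δ_k ≠ 0` at `A₀`: the projectors `f_0, …, f_{k+1}` exist. [cite: KauffmanLins1994, §9.8, Lemma 7.4] -/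
theorem good_klA (k : ℕ) : Good (klA k) (k + 1) := fun m hm => by
  rw [Delta_eq_qint]
  exact mul_ne_zero (pow_ne_zero _ (neg_ne_zero.mpr one_ne_zero)) (qint_klA_ne_zero k (by omega) (by omega))

/-- `Δ_{k+1} = 0` at `A₀`: `f_{k+1}` is negligible. [cite: KauffmanLins1994, §9.8, Lemma 7.5] -/
theorem Delta_klA_r (k : ℕ) : Delta (klA k) (k + 1) = 0 := by
  rw [Delta_eq_qint, qint_klA_r, mul_zero]

end RootOfUnity


/-! ## The root of unity: negligibility of `f_{k+1}`, the spanning hypothesis, vanishing of inadmissible nets -/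

section RootOfUnityTL

open Mor

variable {A : K}

/-- When `f_J` is negligible, morphisms through projectors of size `≤ J` are, modulo negligibles, morphisms through
projectors of size `< J`. [cite: KauffmanLins1994, §7.1 (Lemma 17, proof)] -/
theorem thruSpan_succ_le_sup (hA : A ≠ 0) {J : ℕ} (hJ : jw A J ∈ Neg A J J) :
    thruSpan A (J + 1) m n ≤ thruSpan A J m n ⊔ Neg A m n := by
  rw [thruSpan, Submodule.span_le]
  rintro _ ⟨j, P, Q, hj, hP, hQ, rfl⟩
  rcases Nat.lt_succ_iff_lt_or_eq.mp hj with hj' | rfl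
  · exact Submodule.mem_sup_left (thruSpan.gen_mem hj' hP hQ)
  · exact Submodule.mem_sup_right (Neg.mem_comp hA (Neg.comp_mem hJ hP) hQ)

/-- **The spanning hypothesis at a root of unity**: if `Δ_0, …, Δ_{J-1} ≠ 0` and `Δ_J = 0`, every identity
decomposes, modulo negligible morphisms, through projectors of size `< J`.
[cite: KauffmanLins1994, §7.1 Lemma 17, §9.8 Lemma 7.5] -/
theorem idm_mem_thruSpan_sup_neg (hA : A ≠ 0) {J : ℕ} (hg : Good A J) (hΔ : Delta A J = 0) :
    ∀ n : ℕ, (idm n : Mor K n n) ∈ thruSpan A J n n ⊔ Neg A n n := by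
  have hJ : jw A J ∈ Neg A J J := jw_mem_neg hA hg hΔ
  have hS' : ∀ i, i < J → idm (i + 1) - jw A (i + 1) ∈ thruSpan A (i + 1) (i + 1) (i + 1) :=
    fun i hi => idm_sub_jw_mem_thruSpan hA (i + 1) (hg.mono hi)
  intro n
  induction n with
  | zero =>
    exact Submodule.mem_sup_left (by
      rcases Nat.eq_zero_or_pos J with rfl | hJ0
      · exact absurd hΔ (by rw [Delta_zero]; exact one_ne_zero)
      · exact thruSpan.mono hJ0 (idm_mem_thruSpan hA 0 (hg.mono (Nat.zero_le _))))
  | succ n IH =>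
    rw [← idm_tens_idm n 1]
    -- `(thruSpan J ⊔ Neg) ⊗ 𝟙 ≤ thruSpan (J+1) ⊔ Neg ≤ thruSpan J ⊔ Neg`
    have key : ∀ X : Mor K n n, X ∈ thruSpan A J n n ⊔ Neg A n n → X ⊗ₘ idm 1 ∈ thruSpan A J (n + 1) (n + 1) ⊔ Neg A (n + 1) (n + 1) := by
      intro X hX
      obtain ⟨Y, hY, Z, hZ, rfl⟩ := Submodule.mem_sup.mp hX
      rw [add_tens]
      refine Submodule.add_mem _ ?_ (Submodule.mem_sup_right (Neg.tens_idm_mem hZ 1))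
      exact thruSpan_succ_le_sup hA hJ (thruSpan.tens_idm_one_mem hA hg hS' hY)
    exact key _ IH

/-- `θ(a,b,c) ≠ 0` at the root of unity for q-admissible triples. [cite: KauffmanLins1994, §9.8 Lemma 7.4, §9.10] -/
theorem thetaL_klA_ne_zero (k : ℕ) {a b c : ℕ} (hT : Tri a b c) (hs : a + b + c ≤ 2 * k) : thetaL (klA k) a b c ≠ 0 := by
  obtain ⟨x, z, y, rfl, rfl, rfl⟩ := hT.decompose
  have hF : ∀ n, n ≤ k + 1 → qfact (klA k) n ≠ 0 := fun n hn => qfact_klA_ne_zero k hn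
  have hG := good_klA k
  have h := theta_formula_lim (norm_klA k) z x y (hG.mono (by omega)) (hG.mono (by omega)) (hG.mono (by omega))
  rw [thetaL_eq]
  intro h0
  rw [h0, zero_mul] at h
  exact absurd h.symm (mul_ne_zero (mul_ne_zero (mul_ne_zero (mul_ne_zero (pow_ne_zero _ (neg_ne_zero.mpr one_ne_zero))
    (hF _ (by omega))) (hF _ (by omega))) (hF _ (by omega))) (hF _ (by omega)))

/-- `θ(a,b,c) = 0` at the root of unity for triples with `a, b, c ≤ k` violating the level bound `a + b + c ≤ 2k`.
[cite: KauffmanLins1994, §9.8 Lemma 7.5, §9.10] -/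
theorem thetaL_klA_eq_zero (k : ℕ) {a b c : ℕ} (hT : Tri a b c) (ha : a ≤ k) (hb : b ≤ k) (hc : c ≤ k)
    (hs : 2 * k < a + b + c) : thetaL (klA k) a b c = 0 := by
  obtain ⟨x, z, y, rfl, rfl, rfl⟩ := hT.decompose
  have hG := good_klA k
  have h := theta_formula_lim (norm_klA k) z x y (hG.mono (by omega)) (hG.mono (by omega)) (hG.mono (by omega))
  rw [qfact_klA_eq_zero k (show k + 2 ≤ x + y + z + 1 by omega)] at h
  simp only [mul_zero, zero_mul] at h
  rw [thetaL_eq]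
  rcases mul_eq_zero.mp h with h' | h'
  · exact h'
  · exact absurd h' (mul_ne_zero (mul_ne_zero (qfact_klA_ne_zero k (by omega)) (qfact_klA_ne_zero k (by omega)))
      (qfact_klA_ne_zero k (by omega)))

/-- `Tet` vanishes when the vertex `(a,b,f)` of the left tree is negligible. [cite: KauffmanLins1994, §9.8 Lemma 7.5] -/
theorem Tnet_eq_zero_of_thetaL_abf (hA : A ≠ 0) {a b c e f g : ℕ} (hga : Good A a) (hgb : Good A b) (hgf : Good A f)
    (h : thetaL A a b f = 0) : Tnet A a b c e f g = 0 := by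
  have hV := V_mem_neg_of_thetaL_eq_zero hA hga hgb hgf h
  have hL : treeL A a b c e f ∈ Neg A e (a + b + c) :=
    Neg.mem_comp hA (Neg.tens_idm_mem hV c) (IsTL.V f c e)
  exact Neg.trAll_eq_zero hL (IsTL.treeRd a b c e g)

/-- `Tet` vanishes when the vertex `(f,c,e)` of the left tree is negligible. [cite: KauffmanLins1994, §9.8 Lemma 7.5] -/
theorem Tnet_eq_zero_of_thetaL_fce (hA : A ≠ 0) {a b c e f g : ℕ} (hgf : Good A f) (hgc : Good A c) (hge : Good A e)
    (h : thetaL A f c e = 0) : Tnet A a b c e f g = 0 := by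
  have hV := V_mem_neg_of_thetaL_eq_zero hA hgf hgc hge h
  have hL : treeL A a b c e f ∈ Neg A e (a + b + c) := Neg.comp_mem hV ((IsTL.V a b f).tens_idm c)
  exact Neg.trAll_eq_zero hL (IsTL.treeRd a b c e g)

/-- **At the root of unity the recoupling coefficient vanishes off the q-admissible tetrahedra.**
[cite: KauffmanLins1994, §9.12 ("sum over q-admissibles")] -/
theorem Fco_klA_eq_zero_of_not_adm (k : ℕ) {a b c e f g : ℕ} (ha : a ≤ k) (hb : b ≤ k) (hc : c ≤ k) (he : e ≤ k)
    (hf : f ≤ k) (hg : g ≤ k)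
    (h : ¬((Tri a b f ∧ a + b + f ≤ 2 * k) ∧ (Tri f c e ∧ f + c + e ≤ 2 * k) ∧ (Tri b c g ∧ b + c + g ≤ 2 * k) ∧
      (Tri a g e ∧ a + g + e ≤ 2 * k))) :
    Fco (klA k) a b c e f g = 0 := by
  have hG := good_klA k
  have h0 := klA_ne_zero k
  by_cases h1 : Tri a b f ∧ a + b + f ≤ 2 * k
  · by_cases h2 : Tri f c e ∧ f + c + e ≤ 2 * k
    · by_cases h3 : Tri b c g ∧ b + c + g ≤ 2 * k
      · have h4 : ¬(Tri a g e ∧ a + g + e ≤ 2 * k) := fun h4 => h ⟨h1, h2, h3, h4⟩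
        apply Fco_eq_zero_of_left
        by_cases hT : Tri a g e
        · exact thetaL_klA_eq_zero k hT ha hg he (Nat.lt_of_not_le fun hs => h4 ⟨hT, hs⟩)
        · exact thetaL_of_not_tri hT
      · apply Fco_eq_zero_of_right
        by_cases hT : Tri b c g
        · exact thetaL_klA_eq_zero k hT hb hc hg (Nat.lt_of_not_le fun hs => h3 ⟨hT, hs⟩)
        · exact thetaL_of_not_tri hT
    · rw [Fco]
      by_cases hT : Tri f c e
      · rw [Tnet_eq_zero_of_thetaL_fce h0 (hG.mono (by omega)) (hG.mono (by omega)) (hG.mono (by omega))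
          (thetaL_klA_eq_zero k hT hf hc he (Nat.lt_of_not_le fun hs => h2 ⟨hT, hs⟩)), zero_mul, zero_div]
      · rw [Tnet, treeL, V_of_not_tri hT, comp_zero, comp_zero, trAll_zero_mor, zero_mul, zero_div]
  · rw [Fco]
    by_cases hT : Tri a b f
    · rw [Tnet_eq_zero_of_thetaL_abf h0 (hG.mono (by omega)) (hG.mono (by omega)) (hG.mono (by omega))
        (thetaL_klA_eq_zero k hT ha hb hf (Nat.lt_of_not_le fun hs => h1 ⟨hT, hs⟩)), zero_mul, zero_div]
    · rw [Tnet, treeL, V_of_not_tri hT, zero_tens, zero_comp, comp_zero, trAll_zero_mor, zero_mul, zero_div]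

/-- **The truncated pentagon at the root of unity** (`J = k + 1`, sum over labels `≤ k`).
[cite: KauffmanLins1994, §7.3 Prop. 10, §9.14] -/
theorem pentagon_klA (k : ℕ) {a b c d e f g : ℕ} (ha : a ≤ k) (hb : b ≤ k) (hc : c ≤ k) (hd : d ≤ k) (he : e ≤ k)
    (hf : f ≤ k) (hg : g ≤ k) (k' l' : ℕ) (hk' : k' ≤ k) (hl' : l' ≤ k) :
    Fco (klA k) f c d e g l' * Fco (klA k) a b l' e f k' =
      ∑ h ∈ Finset.range (k + 1), Fco (klA k) a b c g f h * Fco (klA k) a h d e g k' * Fco (klA k) b c d k' h l' :=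
  pentagon_Fco (klA_ne_zero k) (good_klA k) (by omega) (by omega) (by omega) (by omega) (by omega) (by omega) (by omega)
    (fun n _ => idm_mem_thruSpan_sup_neg (klA_ne_zero k) (good_klA k) (Delta_klA_r k) n) k' l' (by omega) (by omega)

end RootOfUnityTL


/-! ## Continuity of the closed form; the identification at the root of unity -/

section ClosedAtRoot

open Filter Topology Mor

variable {A₀ : ℂ}

/-- The Racah sum is continuous in `A` when each term satisfies the condition of `cts_tZ`. [folklore] -/
theorem cts_SZ (h0 : A₀ ≠ 0) {a1 a2 a3 a4 b1 b2 b3 : ℤ} {N : ℕ}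
    (h : ∀ s : ℤ, (s - a1 < 0 ∨ s - a2 < 0 ∨ s - a3 < 0 ∨ s - a4 < 0 ∨ b1 - s < 0 ∨ b2 - s < 0 ∨ b3 - s < 0) ∨
      (qfact A₀ (s - a1).toNat ≠ 0 ∧ qfact A₀ (s - a2).toNat ≠ 0 ∧ qfact A₀ (s - a3).toNat ≠ 0 ∧
        qfact A₀ (s - a4).toNat ≠ 0 ∧ qfact A₀ (b1 - s).toNat ≠ 0 ∧ qfact A₀ (b2 - s).toNat ≠ 0 ∧
        qfact A₀ (b3 - s).toNat ≠ 0)) :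
    ContinuousAt (fun A : ℂ => SZ A a1 a2 a3 a4 b1 b2 b3 N) A₀ := by
  unfold SZ
  exact continuousAt_sum _ (fun s _ => cts_tZ h0 (h s))

/-- The term condition from strand bounds: if six of the differences `bⱼ - aᵢ` are `≤ K` and `[m]! ≠ 0` at `A₀` for
`m ≤ K`, every term of the Racah sum is continuous. [folklore] -/
theorem tZ_cond {a1 a2 a3 a4 b1 b2 b3 : ℤ} {K : ℕ}
    (hb : b1 - a1 ≤ K ∧ b1 - a2 ≤ K ∧ b1 - a3 ≤ K ∧ b1 - a4 ≤ K ∧ b2 - a1 ≤ K ∧ b3 - a1 ≤ K)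
    (hF : ∀ m : ℕ, m ≤ K → qfact A₀ m ≠ 0) (s : ℤ) :
    (s - a1 < 0 ∨ s - a2 < 0 ∨ s - a3 < 0 ∨ s - a4 < 0 ∨ b1 - s < 0 ∨ b2 - s < 0 ∨ b3 - s < 0) ∨
      (qfact A₀ (s - a1).toNat ≠ 0 ∧ qfact A₀ (s - a2).toNat ≠ 0 ∧ qfact A₀ (s - a3).toNat ≠ 0 ∧
        qfact A₀ (s - a4).toNat ≠ 0 ∧ qfact A₀ (b1 - s).toNat ≠ 0 ∧ qfact A₀ (b2 - s).toNat ≠ 0 ∧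
        qfact A₀ (b3 - s).toNat ≠ 0) := by
  by_cases h : s - a1 < 0 ∨ s - a2 < 0 ∨ s - a3 < 0 ∨ s - a4 < 0 ∨ b1 - s < 0 ∨ b2 - s < 0 ∨ b3 - s < 0
  · exact Or.inl h
  · right
    push Not at h
    obtain ⟨h1, h2, h3, h4, h5, h6, h7⟩ := h
    obtain ⟨hb1, hb2, hb3, hb4, hb5, hb6⟩ := hb
    refine ⟨hF _ ?_, hF _ ?_, hF _ ?_, hF _ ?_, hF _ ?_, hF _ ?_, hF _ ?_⟩ <;> omega

/-- The closed form `sixjP` is continuous in `A` under the term condition and nonvanishing of its three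
denominator factorials at `A₀`. [folklore] -/
theorem cts_sixjP (h0 : A₀ ≠ 0) {a b l e f k a1 a2 a3 a4 : ℤ}
    (hden : qfactZ A₀ f * qfactZ A₀ (a1 + 1) * qfactZ A₀ (a2 + 1) ≠ 0)
    (h : ∀ s : ℤ, (s - a1 < 0 ∨ s - a2 < 0 ∨ s - a3 < 0 ∨ s - a4 < 0 ∨ (a1 + a3 - a) - s < 0 ∨ (a1 + a4 - e) - s < 0 ∨
        (a1 + a2 - k) - s < 0) ∨
      (qfact A₀ (s - a1).toNat ≠ 0 ∧ qfact A₀ (s - a2).toNat ≠ 0 ∧ qfact A₀ (s - a3).toNat ≠ 0 ∧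
        qfact A₀ (s - a4).toNat ≠ 0 ∧ qfact A₀ ((a1 + a3 - a) - s).toNat ≠ 0 ∧ qfact A₀ ((a1 + a4 - e) - s).toNat ≠ 0 ∧
        qfact A₀ ((a1 + a2 - k) - s).toNat ≠ 0)) :
    ContinuousAt (fun A : ℂ => sixjP A a b l e f k a1 a2 a3 a4) A₀ := by
  unfold sixjP
  refine ContinuousAt.div ?_ (((cts_qfactZ h0 _).mul (cts_qfactZ h0 _)).mul (cts_qfactZ h0 _)) hden
  refine ContinuousAt.mul (ContinuousAt.mul (ContinuousAt.mul ?_ ?_) ?_) (cts_SZ h0 h)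
  · exact continuousAt_const.mul (cts_qfactZ h0 _)
  · exact ((cts_qfactZ h0 _).mul (cts_qfactZ h0 _)).mul (cts_qfactZ h0 _)
  · exact ((cts_qfactZ h0 _).mul (cts_qfactZ h0 _)).mul (cts_qfactZ h0 _)

/-- **The recoupling coefficients at the root of unity are given by the closed form** on the q-admissible
tetrahedra: `F^{abl}_{e;fk}(A₀) = sixjR(A₀)`, by continuity from the generic identification.
[cite: KauffmanLins1994, §9.11–§9.12, §7.3 Prop. 11] -/
theorem Fco_klA_eq_sixjR (k : ℕ) {a b l e f k' : ℕ} (ha : a ≤ k) (hb : b ≤ k) (hl : l ≤ k) (he : e ≤ k) (hf : f ≤ k)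
    (hk' : k' ≤ k) (h1 : Tri a b f ∧ a + b + f ≤ 2 * k) (h2 : Tri f l e ∧ f + l + e ≤ 2 * k)
    (h3 : Tri b l k' ∧ b + l + k' ≤ 2 * k) (h4 : Tri a k' e ∧ a + k' + e ≤ 2 * k) :
    Fco (klA k) a b l e f k' = sixjR (klA k) a b l e f k' := by
  have hG := good_klA k
  have h0 := klA_ne_zero k
  have hF : ∀ m : ℕ, m ≤ k + 1 → qfact (klA k) m ≠ 0 := fun m hm => qfact_klA_ne_zero k hm
  have hT : Tri a b f ∧ Tri f l e ∧ Tri b l k' ∧ Tri a k' e := ⟨h1.1, h2.1, h3.1, h4.1⟩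
  have p1 := h1.1; have p2 := h2.1; have p3 := h3.1; have p4 := h4.1
  unfold Tri at p1 p2 p3 p4
  have key := eq_zero_of_generic (g := fun A => Fco A a b l e f k' - sixjR A a b l e f k') (norm_klA k) ?_ ?_
  · exact sub_eq_zero.mp key
  · refine ContinuousAt.sub ?_ ?_
    · exact cts_Fco h0 a b l e f k' (hG.mono (by omega)) (hG.mono (by omega)) (hG.mono (by omega)) (hG.mono (by omega))
        (hG.mono (by omega)) (hG.mono (by omega))
        (mul_ne_zero (thetaL_klA_ne_zero k h4.1 h4.2) (thetaL_klA_ne_zero k h3.1 h3.2))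
    · have hfun : (fun A : ℂ => sixjR A a b l e f k') = fun A => sixjP A a b l e f k' ((a + e + k') / 2 : ℕ)
          ((b + l + k') / 2 : ℕ) ((a + b + f) / 2 : ℕ) ((l + e + f) / 2 : ℕ) := by
        funext A; rw [sixjR_of_tri hT]
      rw [hfun]
      refine cts_sixjP h0 ?_ (tZ_cond (K := k + 1) ⟨?_, ?_, ?_, ?_, ?_, ?_⟩ hF)
      · rw [show (((a + e + k') / 2 : ℕ) : ℤ) + 1 = (((a + e + k') / 2 + 1 : ℕ) : ℤ) by push_cast; ring,
          show (((b + l + k') / 2 : ℕ) : ℤ) + 1 = (((b + l + k') / 2 + 1 : ℕ) : ℤ) by push_cast; ring,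
          qfactZ_natCast, qfactZ_natCast, qfactZ_natCast]
        exact mul_ne_zero (mul_ne_zero (hF _ (by omega)) (hF _ (by omega))) (hF _ (by omega))
      all_goals omega
  · intro A hA
    have hA0 : A ≠ 0 := by intro h; rw [h, norm_zero] at hA; exact absurd hA (by norm_num)
    exact sub_eq_zero.mpr (Fco_eq_sixjR hA0 (hq_of_one_lt_norm hA) (qint_ne_zero_of_one_lt_norm hA) l a b e f k')

end ClosedAtRoot



end TemperleyLieb

end Literature.RepresentationTheory.ModularTensorCategories
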